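import Summits.KontsevichZagierPeriods.KontsevichZagierPeriods.Theorems.PentagonInKZ.Negative.KernelImplies
import Summits.KontsevichZagierPeriods.KontsevichZagierPeriods.Theorems.PentagonInKZ.Negative.LoadBearing
import Summits.KontsevichZagierPeriods.KontsevichZagierPeriods.Theorems.PentagonInKZ.Negative.Regularisation
import Summits.KontsevichZagierPeriods.KontsevichZagierPeriods.Theorems.PentagonInKZ.Negative.RulesAssociator
import Summits.KontsevichZagierPeriods.KontsevichZagierPeriods.Theorems.PentagonInKZ.Negative.WeightThreeTightness
import Literature.NumberTheory.Transcendental.MZVShuffleRegularisationProofs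
import Literature.Barriers.KontsevichZagierPeriods.PeriodEqualityDecidability

/-!
# Disproof work file for the crux `PentagonInKZ` (stmt-KontsevichZagierPeriods-11348)

Standing adversary (cdisprove seat; generations 1–3) on
`Summit.KontsevichZagierPeriods.KontsevichZagierPeriods.Theses.FurushoPentagon.PentagonInKZ`
(realisation form: for every commutative `ℚ`-algebra `R`, every realisation `χ` of the KZ rules
and every assignment `Z` of the simplex classes, the `χ`-valued shuffle-regularised MZV series
`Φ_χ` satisfies Drinfeld's pentagon).

LAYOUT (generation 3).  Sections §1–§15 (generation 2) have LANDED verbatim as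
`Theorems/PentagonInKZ/Negative/{EvalInstance,KernelImplies,LoadBearing,LowWeight,Regularisation,
Dispensable,RulesAssociator,Tightness}.lean`; generation 3 landed `WeightThreeShape` (p74636),
`WeightThreeTightness` (p75289), `WeightThreeFaithful` (p75677), `WeightFourShape` (p76075), with
`DualityWeightThree` (p76835) and `WeightFourLinear` (p77000) in the review queue and
`WeightFourTightness` (checked rc 0) to follow them — all in the namespace
`Summit.KontsevichZagierPeriods.FurushoPentagon.PentagonInKZNegative`.  This work file IMPORTS the
landed-and-built files, lives in the same namespace, and carries (i) the findings index below,
(ii) verbatim bodies of the generation-3 files not yet built on the farm (sections `Pending…`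
below; they are deleted here as the tree catches up), (iii) the TARGETS analysis of the lead's
skeleton (§17, end of file).

## Findings (index)

* §1 vocabulary: `cruxSeries R χ Z` (the series of the crux), `IsRealisation`, `pentagonInKZ_iff`
  (`Iff.rfl`), `pentagonInKZ_iff'`.
* §2 **EVALUATION INSTANCE IS A THEOREM** (new, cycle 2): at `R = ℝ`, `χ = KZ.eval`, any `Z`
  agreeing with the simplex classes, `cruxSeries = drinfeldAssociator` coefficientwise
  (`cruxSeries_eval_eq_drinfeldAssociator`) and the crux's conclusion HOLDS
  (`pentagon_evalInstance`, from the tree's proof of Drinfeld's theorem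
  `drinfeldAssociator_pentagon_holds`).  So the crux's conventions (signs, word order, slot order,
  two-sided regularisation) are EXACTLY Drinfeld's `Φ_KZ`, kernel-checked in all weights
  (supersedes generation 1's numerical check to weight 8): no formalisation-level counterexample
  exists at `χ = eval`.
* §3 augmentation `ε : U𝔞₄/(deg>N) → R` (`t_ij ↦ 0`), `c_∅² = c_∅³` for every pentagon solution,
  the unit `χ [pt,1] = 1` from H1–H3 (`chi_unit`), constant / linear / weight-3 coefficients.
* §4 LOAD-BEARING HYPOTHESES as theorems: multiplicativity H2 (`not_pentagonInKZWithoutMul`,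
  witness `χ = -eval`), the assignment hypothesis on `Z` (`not_pentagonInKZWithoutZ`, witness
  `Z ≡ 2[pt,1]`) and even its `u = []` instance alone (`not_pentagonInKZWithoutZNil`).
* §5 EXACT LOW-WEIGHT CONTENT in every realisation: weight 3 `χ(Z[3]) = χ(Z[2,1])`
  (`weight_three_content`, via the landed `NCSeries.DrinfeldPentagon.apply_weight_three`).
* §6 (new, generic associator algebra) base-change model `R ⊗_ℚ U𝔞_ℚ/(deg>N)` of
  `DrinfeldKohnoTrunc R ι N` (`toModel`/`ofModel`, `toModel_injective`, naturality `toModel_map`),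
  `DrinfeldKohnoTrunc.map_injective` for injective maps of `ℚ`-algebras, and
  **`NCSeries.DrinfeldPentagon.of_map_injective`: the pentagon is reflected along injective
  coefficient maps** — LANDED as `Literature/…/AssociatorsBaseChange.lean` (p71442).
* §7 **WHY IT RESISTS — THE SUMMIT IMPLIES THE CRUX** (new): `pentagonInKZ_of_kernel :
  KZKernelConjecture → PentagonInKZ` and, the summit being equivalent to the kernel conjecture in
  the tree (`KontsevichZagierPeriods_iff`, `kzKernelConjecture_iff_isRational`),
  `pentagonInKZ_of_summit : KontsevichZagierPeriods → PentagonInKZ`; contrapositives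
  `not_kernel_of_not_pentagonInKZ`, `not_summit_of_not_pentagonInKZ`.  Ingredients: `reg_ш` is
  `ℤ`-valued (`intValued_shuffleReg`), so each coefficient of `Φ_χ` is `χ` of ONE formal
  combination (`cruxLift`, `chi_cruxLift`); the `ℚ`-subalgebra `Peff ⊆ ℝ` of values;
  factorisation `realise` of `χ` through `Peff`; Drinfeld's theorem reflected along `Peff ↪ ℝ`
  (`pentagon_phiPeff`) and pushed forward.  HENCE: any kill of this crux is a DISPROOF OF THE
  SUMMIT — an additive, multiplicative move-invariant finer than evaluation.  Together with §2
  this closes both refutation avenues (mis-formalisation; exotic realisation).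
* §8 WEIGHT-4 CONTENT (re-derived from the landed `apply_weight_four`, with `reg_ш(xx) =
  reg_ш(yy) = 0`, `c_{yx} = -c_{xy}` computed here): in every realisation
  `5χ⟦ζ(4)⟧ = 2χ⟦ζ(2)⟧²`, `10χ⟦ζ(3,1)⟧ = χ⟦ζ(2)⟧²`, `10χ⟦ζ(2,2)⟧ = 3χ⟦ζ(2)⟧²`,
  `5χ⟦ζ(2,1,1)⟧ = 2χ⟦ζ(2)⟧²` (`weight_four_content`); hence `χ⟦ζ(4)⟧ = 4χ⟦ζ(3,1)⟧` (item 0275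
  ⊗ ℚ, `zeta4_eq_four_zeta31`), weight-4 duality, the weight-4 STUFFLE and SHUFFLE
  (`weight_four_stuffle`, `weight_four_shuffle`): the crux at its second rung already contains the
  first non-dissection relation.
* §9 REFUTED VARIANT: the sign-less series (`(-1)^{#X₁}` dropped) violates the pentagon at
  `χ = eval` in weight 3 (`not_pentagonInKZNoSign`: `ζ(3) + ζ(2,1) ≠ 0` by positivity).
* §10 H1 LOAD-BEARING: the point-evaluation character `χ_a([σ,f]) = f(a,…,a)` is additive,
  multiplicative (Fubini integrands multiply pointwise) and unital but breaks weight 3 at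
  `a = 1/3` (`27/2 ≠ 27/4`; `not_pentagonInKZWithoutRel`) — any proof must use the moves.
* §11 **H3 (non-degeneracy) is NOT load-bearing** (new): `pentagonInKZ_iff_withoutUnit :
  PentagonInKZ ↔ PentagonInKZWithoutUnit` — for `χ` with H1, H2 only, `e = χ[pt,1]` is idempotent
  with `χ = e·χ`; pentagon over `R/(1-e)` by the crux, over `R/(e)` trivially (zero series),
  over `R/(1-e) × R/(e)` from the factors (`drinfeldPentagon_of_fst_snd`, base-change models) and
  over `R` by descent along the injection (`DrinfeldPentagon.of_map_injective`).
* §12 **`[Algebra ℚ R]` is redundant** (new): H1–H3 force every `n ≠ 0` to be a unit in `R`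
  (`isUnit_natCast_of_isRealisation`: `[pt,1] ≡ n·[pt,1/n]` by integrand additivity).
* §13 **`pentagonInKZ_iff_rulesAssociator : PentagonInKZ ↔ DrinfeldPentagon KZ.rulesAssociator`**
  (new, tree-visible re-derivation of the planner's evidence-only `Equiv2.lean`): universal
  realisation `chiUniv : FormalRep → P_ℚ`, `cruxSeries_chiUniv = rulesAssociator`, descent
  `descendQ χ : P_ℚ →ₐ[ℚ] R` of any realisation.  Provers may work over `P_ℚ`.
* §14 **REGULARISATION IS LOAD-BEARING ALREADY IN WEIGHT 2** (new): with the raw convergent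
  classes and `0` on divergent words (`cruxSeriesNoReg`) the pentagon fails at `χ = eval`
  (`not_pentagonInKZNoReg`): the pentagon forces `c_{yx} = -c_{xy}`
  (`DrinfeldPentagon.apply_weight_two`, NEW Literature file `AssociatorsPentagonWeightTwo.lean`,
  p72312, which also removes the weight-2 hypotheses of `apply_weight_four`), i.e. the first
  regularised coefficient `c_{yx}(Φ) = +χ⟦ζ(2)⟧` is pinned by the pentagon.
* §15 **TIGHTNESS — the crux HOLDS unconditionally modulo weight 3** (new): `pentAt_le_two` —
  for every realisation and agreeing `Z` the pentagon identity holds in the truncations `N ≤ 2`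
  (shape by regularisation, level 2 by locality alone: `pentAt_two_of_shape`); the first rung of
  any proof or refutation is weight 3 (= `χ⟦ζ(3)⟧ = χ⟦ζ(2,1)⟧`, §5).
* SUMMARY OF THE HYPOTHESIS ANALYSIS: H1 (moves), H2 (multiplicativity), the `Z`-assignment
  (even at `u = []`), the sign `(-1)^{#X₁}` and the regularisation of divergent words are each
  load-bearing (§4, §9, §10, §14); H3 and
  `[Algebra ℚ R]` are not (§11, §12).  WHY NO KILL: §2 (eval instance proved) + §7 (kernel
  conjecture ⇒ crux).  WHAT A PROOF MUST DELIVER EARLY: §5/§8 (duality at weight 3; all weight-4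
  relations incl. the stuffle and 0275, rationally).
* §16 (generation 3) **THE SECOND RUNG IS CLOSED — THE CRUX HOLDS UNCONDITIONALLY MODULO
  WEIGHT 4** (`pentAt_le_three`, end of this file): (a) with NO hypothesis on `χ`,
  `Σ_{w ∈ a ш v} Φ_χ(w) = 0` for every letter `a` (`reg_ш` multiplicative and killing letters;
  LANDED `sum_cruxSeries_shuffle_letter`), whence ALL eight weight-3 coefficients of `Φ_χ`
  (`cruxSeries_xxx/_yyy = 0`, `_xxy = -z₃`, `_xyx = 2z₃`, `_yxx = -z₃`, `_xyy = z₂₁`,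
  `_yxy = -2z₂₁`, `_yyx = z₂₁`; LANDED): `Φ_χ ≡ 1 + c[x,y] + p[x,[x,y]] + q[[x,y],y]` mod weight 4
  with no group-likeness hypothesis (`evalTrunc_three_of_shape`, LANDED); (b) for ANY series of
  that shape the level-3 pentagon identity is LINEAR, `c·D[K₂] + p·D[U] + q·D[V] = 0` in
  `U𝔞₄ ⊗ R/(deg>3)` (`pentAt_three_iff_of_shape`), with `D[K₂] = 0` (locality,
  `pentD_K₂_eq_zero`) and `D[U] = D[V]` (`pentD_KU_eq_KV`: read off Drinfeld's theorem over `ℝ` —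
  `ζ(3)·(D[V]-D[U]) = 0`, `ζ(3) > 0` — and transported to `ℚ` by injectivity of base change and to
  any `R` by functoriality); hence `pentAt_three_of_shape` (converse of `apply_weight_three`) and
  `cruxSeries_pentAt_three_iff : PentAt Φ_χ 3 ↔ (χ⟦ζ(2,1)⟧ - χ⟦ζ(3)⟧)·D[U] = 0`; (c) `D[U]` is
  FAITHFUL (`pentD_KU_faithful`: entry `((0,0),(3,3))` of its image in the shifted permutation
  representation is `1`), so **`PentAt Φ_χ 3 ↔ χ⟦ζ(3)⟧ = χ⟦ζ(2,1)⟧`**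
  (`cruxSeries_pentAt_three_iff_duality`, `pentAt_le_three_iff_duality`); (d) Euler's
  `ζ(3) = ζ(2,1)` IS ONE MOVE (`mzvRep_three_sub_twoOne_mem_relations`: rule (2) along the duality
  involution `t ↦ (1-t₂,1-t₁,1-t₀)`, `|det| = 1`; the instance `s = (3)` of the support item
  DualityInKZ, stmt-3933), so `chi_Z3_eq_Z21` in every realisation and `pentAt_le_three`:
  `PentAt Φ_χ N` for all `N ≤ 3`, every realisation, every agreeing `Z`.  CONSEQUENCE FOR
  EVERYONE: a refutation of the crux lives in weight `≥ 4`; the weight-4 rung is EXACTLY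
  `weight_four_content` (§8), of which duality `z₂₁₁ = z₄` (one move) and the shuffle
  `z₂² = 2z₂₂ + 4z₃₁` (a dissection) are cheap, leaving the STUFFLE `z₂² = 2z₂₂ + z₄` and Hoffman's
  weight-4 relation `z₄ = 4z₃₁` ("born from regularisation") as the first genuinely
  two-dimensional content a proof must supply — and the first place a disproof could bite.
* §18 (generation 3) **THE THIRD RUNG IS PINNED — MODULO WEIGHT 5 THE CRUX IS THE FOUR WEIGHT-4
  CLASS RELATIONS**: (a) with NO hypothesis on `χ`, all sixteen weight-4 coefficients of `Φ_χ`
  (`cruxSeries_xxxx … _yyyx`, letter-shuffle identities): `Φ_χ` is a Lie exponential to weight 4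
  EXCEPT for the coefficient of `[x,y]²`, which is `z₂₂ + 2z₃₁` instead of the group-like `z₂²/2`
  (the defect is the SHUFFLE `z₂² = 2z₂₂ + 4z₃₁`, a dissection); (b) the level-4 pentagon identity
  is `c·D[K₂] + p·D[U] + q·D[V] + α₁D[L₁] + α₃₁D[W₃₁] + α₂₂D[K₂²] + α₂₁₁D[L₃] + c²·X = 0`
  (`pentAt_four_iff_of_shape`; `X` the quadratic cross term); (c) universal identities
  `D[U] = D[V]` at level 4 and `10X = 4D[L₁] - D[W₃₁] - 3D[K₂²] + 4D[L₃]` (`level4_identities`: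
  Drinfeld over `ℝ` + WEIGHT SEPARATION by the scaling endomorphism `σ₂ : t ↦ 2t`
  (`exists_scaleHom`) + `ζ(3), ζ(2) ≠ 0` + base change); (d) hence `pentAt_four_of_shape`, the
  converse of `apply_weight_four` at level 4, and `pentAt_le_four_of_weightFour`: in every
  realisation the four relations `5z₄ = 2z₂²`, `10z₃₁ = z₂²`, `10z₂₂ = 3z₂²`, `5z₂₁₁ = 2z₂²` give the
  pentagon for `Φ_χ` at ALL levels `≤ 4`.  Conversely the crux forces them (§8).  WHERE A DISPROOF
  COULD BITE FIRST: an additive, multiplicative, move-killing `χ` violating one of these four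
  class identities — equivalently (given duality and the dissection shuffle) violating the STUFFLE
  `z₂² = 2z₂₂ + z₄` or HOFFMAN's `z₄ = 4z₃₁`; every such `χ` is a disproof of the summit (§7).
* §17 (generation 3) TARGETS = the lead's reshaped skeleton of line `logfree-gauge-corner-flatness`
  (sha 5b456436…; stubs `stub_pathFamilies`, `stub_shuffleProduct`, `stub_groupLike`,
  `stub_halfEdgeUniversal`, `stub_chartB`, `stub_logfreeCorners`): verdicts at the end of this
  file — all paper-TRUE at `χ = eval` (so refutable only through an exotic realisation = a summit
  disproof), no technical falsity in the signatures, numerics job recorded there.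
-/

set_option linter.dupNamespace false

noncomputable section

open Literature.NumberTheory.Transcendental

namespace Summit.KontsevichZagierPeriods.FurushoPentagon.PentagonInKZNegative

open Summit.KontsevichZagierPeriods.KontsevichZagierPeriods.Theses.FurushoPentagon (PentagonInKZ)

/-! ## §1–§15, §16a–d: LANDED AND BUILT (see the imports and the index above) -/

/-- Index anchor: the summit implies the crux (§7, landed `pentagonInKZ_of_summit`). [folklore] -/
example : KontsevichZagierPeriods → PentagonInKZ := pentagonInKZ_of_summit

/-- Index anchor: the crux is the pentagon for the rules associator (§13, landed). [folklore] -/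
example : PentagonInKZ ↔ NCSeries.DrinfeldPentagon KZ.rulesAssociator := pentagonInKZ_iff_rulesAssociator

/-- Index anchor: the eval instance is Drinfeld's theorem (§2, landed). [folklore] -/
example {Z : List ℕ → KZ.FormalRep} (hZ : AgreesWithSimplex Z) :
    NCSeries.DrinfeldPentagon (cruxSeries ℝ KZ.eval Z) := pentagon_evalInstance hZ

section Pending16ef_Faithful
open Matrix
open scoped Kronecker

open Summit.KontsevichZagierPeriods.KontsevichZagierPeriods.Theses.FurushoPentagon (PentagonInKZ)

/-! ## §16e Faithfulness of `D[U]` -/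

section Faithful

open NCSeries.PermRep

variable {S : Type} [CommRing S]

/-- **`D[U]` is faithful**: `r · D[U] = 0` in `U𝔞₄ ⊗ S/(deg > 3)` forces `r = 0` (apply the
shifted permutation representation and read the entry `((0,0),(3,3))`, which is `r · 1`).
[cite: BarNatan1998, §3] -/
theorem pentD_KU_faithful (r : S) (h : r • pentD S 3 KU = 0) : r = 0 := by
  obtain ⟨W, hW⟩ := exists_algHom (S := S)
  have hp := congrArg W h
  rw [map_smul, map_zero] at hp
  simp only [pentD, KU, map_sub, map_add, map_mul, hW, v] at hp
  simp only [← Matrix.add_kronecker, ← map_add (Fm S)] at hp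
  simp only [← Matrix.mul_kronecker_mul, ← map_mul (Fm S)] at hp
  have he := congrArg (fun M : Matrix (Fin 4 × Fin 4) (Fin 4 × Fin 4) S =>
    M ((0 : Fin 4), (0 : Fin 4)) ((3 : Fin 4), (3 : Fin 4))) hp
  simp only [Matrix.smul_apply, Matrix.sub_apply, Matrix.add_apply, Matrix.kroneckerMap_apply,
    Matrix.zero_apply, smul_eq_mul] at he
  -- the fifteen decided integer entries `(word(A_k,B_k))₀₃`
  have ent1_fft : (Qz (0, 1) * Qz (0, 1) * (Qz (1, 2) + Qz (1, 3))) 0 3 = -2 := by decide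
  have ent1_ftf : (Qz (0, 1) * (Qz (1, 2) + Qz (1, 3)) * Qz (0, 1)) 0 3 = 0 := by decide
  have ent1_tff : ((Qz (1, 2) + Qz (1, 3)) * Qz (0, 1) * Qz (0, 1)) 0 3 = 0 := by decide
  have ent2_fft : ((Qz (0, 2) + Qz (1, 2)) * (Qz (0, 2) + Qz (1, 2)) * Qz (2, 3)) 0 3 = -3 := by decide
  have ent2_ftf : ((Qz (0, 2) + Qz (1, 2)) * Qz (2, 3) * (Qz (0, 2) + Qz (1, 2))) 0 3 = 0 := by decide
  have ent2_tff : (Qz (2, 3) * (Qz (0, 2) + Qz (1, 2)) * (Qz (0, 2) + Qz (1, 2))) 0 3 = 0 := by decide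
  have ent3_fft : (Qz (1, 2) * Qz (1, 2) * Qz (2, 3)) 0 3 = 0 := by decide
  have ent3_ftf : (Qz (1, 2) * Qz (2, 3) * Qz (1, 2)) 0 3 = 0 := by decide
  have ent3_tff : (Qz (2, 3) * Qz (1, 2) * Qz (1, 2)) 0 3 = 0 := by decide
  have ent4_fft : ((Qz (0, 1) + Qz (0, 2)) * (Qz (0, 1) + Qz (0, 2)) * (Qz (1, 3) + Qz (2, 3))) 0 3 = -6 := by decide
  have ent4_ftf : ((Qz (0, 1) + Qz (0, 2)) * (Qz (1, 3) + Qz (2, 3)) * (Qz (0, 1) + Qz (0, 2))) 0 3 = 0 := by decide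
  have ent4_tff : ((Qz (1, 3) + Qz (2, 3)) * (Qz (0, 1) + Qz (0, 2)) * (Qz (0, 1) + Qz (0, 2))) 0 3 = 0 := by decide
  have ent5_fft : (Qz (0, 1) * Qz (0, 1) * Qz (1, 2)) 0 3 = 0 := by decide
  have ent5_ftf : (Qz (0, 1) * Qz (1, 2) * Qz (0, 1)) 0 3 = 0 := by decide
  have ent5_tff : (Qz (1, 2) * Qz (0, 1) * Qz (0, 1)) 0 3 = 0 := by decide
  simp only [RingHom.mapMatrix_apply, Matrix.map_apply, Jz_facts.2.2, ent1_fft, ent1_ftf, ent1_tff,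
    ent2_fft, ent2_ftf, ent2_tff, ent3_fft, ent3_ftf, ent3_tff, ent4_fft, ent4_ftf, ent4_tff,
    ent5_fft, ent5_ftf, ent5_tff, map_zero, map_one, map_neg, map_ofNat, mul_one,
    add_zero, sub_zero] at he
  linear_combination he

end Faithful

/-! ## §16f The crux modulo weight 4 is EXACTLY weight-3 duality, realisation by realisation -/

section Exact

variable {R : Type} [CommRing R] [Algebra ℚ R] {χ : KZ.FormalRep →+ R} {Z : List ℕ → KZ.FormalRep}

/-- **`PentAt Φ_χ 3 ↔ χ⟦ζ(3)⟧ = χ⟦ζ(2,1)⟧` in every realisation.** [cite: Furusho2011, §2] -/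
theorem cruxSeries_pentAt_three_iff_duality (hχ : IsRealisation R χ) (hZ : AgreesWithSimplex Z) :
    NCSeries.PentAt (cruxSeries R χ Z) 3 ↔ χ (Z [3]) = χ (Z [2, 1]) := by
  rw [cruxSeries_pentAt_three_iff hχ hZ]
  refine ⟨fun h => ?_, fun h => by rw [h, sub_self, zero_smul]⟩
  have := pentD_KU_faithful _ h
  exact (sub_eq_zero.mp this).symm

/-- **The pentagon for `Φ_χ` in all levels `≤ 3` ↔ weight-3 duality in `χ`.** Together with
`weight_three_content` / `pentagonInKZ_of_summit`: this is the exact second rung of the crux.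
[cite: Furusho2011, §2] -/
theorem pentAt_le_three_iff_duality (hχ : IsRealisation R χ) (hZ : AgreesWithSimplex Z) :
    (∀ N ≤ 3, NCSeries.PentAt (cruxSeries R χ Z) N) ↔ χ (Z [3]) = χ (Z [2, 1]) :=
  ⟨fun h => (cruxSeries_pentAt_three_iff_duality hχ hZ).mp (h 3 le_rfl),
    pentAt_le_three_of_duality hχ hZ⟩

end Exact

end Pending16ef_Faithful

section Pending18abc_WeightFourShape

open Summit.KontsevichZagierPeriods.KontsevichZagierPeriods.Theses.FurushoPentagon (PentagonInKZ)

/-! ## §18a The twelve regularised weight-4 coefficients -/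

section CoeffFour

variable {R : Type} [CommRing R] [Algebra ℚ R] (χ : KZ.FormalRep →+ R) (Z : List ℕ → KZ.FormalRep)

/-- Division by a non-zero natural number in the target of a realisation. [folklore] -/
theorem eq_of_natCast_mul_eq {n : ℕ} (hn : n ≠ 0) {a b : R} (h : (n : R) * a = (n : R) * b) :
    a = b := by
  have hu := NCSeries.isUnit_natCast_of_ne_zero (S := R) (n := n) hn
  have h0 : (n : R) * (a - b) = 0 := by rw [mul_sub, h, sub_self]
  exact sub_eq_zero.mp (hu.mul_right_eq_zero.mp h0)

/-- `Φ_χ(xxxx) = 0` (from `x ш xxx = 4xxxx`). [cite: IharaKanekoZagier2006, §3] -/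
theorem cruxSeries_xxxx : cruxSeries R χ Z [false, false, false, false] = 0 := by
  have h := sum_cruxSeries_shuffle_letter χ Z false [false, false, false] 0 (by decide)
  have hw : MZV.shuffleWord [false] [false, false, false] = [[false, false, false, false],
      [false, false, false, false], [false, false, false, false], [false, false, false, false]] := by
    decide
  rw [hw] at h
  simp only [List.map_cons, List.map_nil, List.sum_cons, List.sum_nil, add_zero] at h
  refine eq_of_natCast_mul_eq (n := 4) (by norm_num) ?_
  rw [mul_zero]; push_cast; linear_combination h

/-- `Φ_χ(yyyy) = 0` (from `y ш yyy = 4yyyy`). [cite: IharaKanekoZagier2006, §3] -/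
theorem cruxSeries_yyyy : cruxSeries R χ Z [true, true, true, true] = 0 := by
  have h := sum_cruxSeries_shuffle_letter χ Z true [true, true, true] 4 (by decide)
  have hw : MZV.shuffleWord [true] [true, true, true] = [[true, true, true, true],
      [true, true, true, true], [true, true, true, true], [true, true, true, true]] := by decide
  rw [hw] at h
  simp only [List.map_cons, List.map_nil, List.sum_cons, List.sum_nil, add_zero] at h
  refine eq_of_natCast_mul_eq (n := 4) (by norm_num) ?_
  rw [mul_zero]; push_cast; linear_combination h

/-- `Φ_χ(xxyx) = -3 c_{xxxy}` (from `x ш xxy = 3xxxy + xxyx`). [cite: IharaKanekoZagier2006, §3] -/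
theorem cruxSeries_xxyx : cruxSeries R χ Z [false, false, true, false] =
    -3 * cruxSeries R χ Z [false, false, false, true] := by
  have h := sum_cruxSeries_shuffle_letter χ Z false [false, false, true] 1 (by decide)
  have hw : MZV.shuffleWord [false] [false, false, true] = [[false, false, false, true],
      [false, false, false, true], [false, false, false, true], [false, false, true, false]] := by
    decide
  rw [hw] at h
  simp only [List.map_cons, List.map_nil, List.sum_cons, List.sum_nil, add_zero] at h
  linear_combination h

/-- `Φ_χ(xyxx) = 3 c_{xxxy}` (from `x ш xyx = 2xxyx + 2xyxx`). [cite: IharaKanekoZagier2006, §3] -/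
theorem cruxSeries_xyxx : cruxSeries R χ Z [false, true, false, false] =
    3 * cruxSeries R χ Z [false, false, false, true] := by
  have h := sum_cruxSeries_shuffle_letter χ Z false [false, true, false] 1 (by decide)
  have hw : MZV.shuffleWord [false] [false, true, false] = [[false, false, true, false],
      [false, false, true, false], [false, true, false, false], [false, true, false, false]] := by
    decide
  rw [hw] at h
  simp only [List.map_cons, List.map_nil, List.sum_cons, List.sum_nil, add_zero,
    cruxSeries_xxyx] at h
  refine eq_of_natCast_mul_eq (n := 2) (by norm_num) ?_
  push_cast; linear_combination h

/-- `Φ_χ(yxxx) = -c_{xxxy}` (from `x ш yxx = xyxx + 3yxxx`). [cite: IharaKanekoZagier2006, §3] -/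
theorem cruxSeries_yxxx : cruxSeries R χ Z [true, false, false, false] =
    -cruxSeries R χ Z [false, false, false, true] := by
  have h := sum_cruxSeries_shuffle_letter χ Z false [true, false, false] 1 (by decide)
  have hw : MZV.shuffleWord [false] [true, false, false] = [[false, true, false, false],
      [true, false, false, false], [true, false, false, false], [true, false, false, false]] := by
    decide
  rw [hw] at h
  simp only [List.map_cons, List.map_nil, List.sum_cons, List.sum_nil, add_zero,
    cruxSeries_xyxx] at h
  refine eq_of_natCast_mul_eq (n := 3) (by norm_num) ?_
  push_cast; linear_combination h

/-- `Φ_χ(xyyx) = -2c_{xxyy} - c_{xyxy}` (from `x ш xyy = 2xxyy + xyxy + xyyx`). [cite: IharaKanekoZagier2006, §3] -/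
theorem cruxSeries_xyyx : cruxSeries R χ Z [false, true, true, false] =
    -2 * cruxSeries R χ Z [false, false, true, true] - cruxSeries R χ Z [false, true, false, true] := by
  have h := sum_cruxSeries_shuffle_letter χ Z false [false, true, true] 2 (by decide)
  have hw : MZV.shuffleWord [false] [false, true, true] = [[false, false, true, true],
      [false, false, true, true], [false, true, false, true], [false, true, true, false]] := by
    decide
  rw [hw] at h
  simp only [List.map_cons, List.map_nil, List.sum_cons, List.sum_nil, add_zero] at h
  linear_combination h

/-- `Φ_χ(yxxy) = -c_{xyxy} - 2c_{xxyy}` (from `y ш xxy = yxxy + xyxy + 2xxyy`). [cite: IharaKanekoZagier2006, §3] -/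
theorem cruxSeries_yxxy : cruxSeries R χ Z [true, false, false, true] =
    -cruxSeries R χ Z [false, true, false, true] - 2 * cruxSeries R χ Z [false, false, true, true] := by
  have h := sum_cruxSeries_shuffle_letter χ Z true [false, false, true] 2 (by decide)
  have hw : MZV.shuffleWord [true] [false, false, true] = [[true, false, false, true],
      [false, true, false, true], [false, false, true, true], [false, false, true, true]] := by
    decide
  rw [hw] at h
  simp only [List.map_cons, List.map_nil, List.sum_cons, List.sum_nil, add_zero] at h
  linear_combination h

/-- `Φ_χ(yxyx) = c_{xyxy} + 4c_{xxyy}` (from `y ш xyx = yxyx + 2xyyx + xyxy`). [cite: IharaKanekoZagier2006, §3] -/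
theorem cruxSeries_yxyx : cruxSeries R χ Z [true, false, true, false] =
    cruxSeries R χ Z [false, true, false, true] + 4 * cruxSeries R χ Z [false, false, true, true] := by
  have h := sum_cruxSeries_shuffle_letter χ Z true [false, true, false] 2 (by decide)
  have hw : MZV.shuffleWord [true] [false, true, false] = [[true, false, true, false],
      [false, true, true, false], [false, true, true, false], [false, true, false, true]] := by
    decide
  rw [hw] at h
  simp only [List.map_cons, List.map_nil, List.sum_cons, List.sum_nil, add_zero,
    cruxSeries_xyyx] at h
  linear_combination h

/-- `Φ_χ(yyxx) = -c_{xxyy}` (from `y ш yxx = 2yyxx + yxyx + yxxy`). [cite: IharaKanekoZagier2006, §3] -/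
theorem cruxSeries_yyxx : cruxSeries R χ Z [true, true, false, false] =
    -cruxSeries R χ Z [false, false, true, true] := by
  have h := sum_cruxSeries_shuffle_letter χ Z true [true, false, false] 2 (by decide)
  have hw : MZV.shuffleWord [true] [true, false, false] = [[true, true, false, false],
      [true, true, false, false], [true, false, true, false], [true, false, false, true]] := by
    decide
  rw [hw] at h
  simp only [List.map_cons, List.map_nil, List.sum_cons, List.sum_nil, add_zero,
    cruxSeries_yxyx, cruxSeries_yxxy] at h
  refine eq_of_natCast_mul_eq (n := 2) (by norm_num) ?_
  push_cast; linear_combination h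

/-- `Φ_χ(yxyy) = -3 c_{xyyy}` (from `y ш xyy = yxyy + 3xyyy`). [cite: IharaKanekoZagier2006, §3] -/
theorem cruxSeries_yxyy : cruxSeries R χ Z [true, false, true, true] =
    -3 * cruxSeries R χ Z [false, true, true, true] := by
  have h := sum_cruxSeries_shuffle_letter χ Z true [false, true, true] 3 (by decide)
  have hw : MZV.shuffleWord [true] [false, true, true] = [[true, false, true, true],
      [false, true, true, true], [false, true, true, true], [false, true, true, true]] := by
    decide
  rw [hw] at h
  simp only [List.map_cons, List.map_nil, List.sum_cons, List.sum_nil, add_zero] at h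
  linear_combination h

/-- `Φ_χ(yyxy) = 3 c_{xyyy}` (from `y ш yxy = 2yyxy + 2yxyy`). [cite: IharaKanekoZagier2006, §3] -/
theorem cruxSeries_yyxy : cruxSeries R χ Z [true, true, false, true] =
    3 * cruxSeries R χ Z [false, true, true, true] := by
  have h := sum_cruxSeries_shuffle_letter χ Z true [true, false, true] 3 (by decide)
  have hw : MZV.shuffleWord [true] [true, false, true] = [[true, true, false, true],
      [true, true, false, true], [true, false, true, true], [true, false, true, true]] := by
    decide
  rw [hw] at h
  simp only [List.map_cons, List.map_nil, List.sum_cons, List.sum_nil, add_zero,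
    cruxSeries_yxyy] at h
  refine eq_of_natCast_mul_eq (n := 2) (by norm_num) ?_
  push_cast; linear_combination h

/-- `Φ_χ(yyyx) = -c_{xyyy}` (from `y ш yyx = 3yyyx + yyxy`). [cite: IharaKanekoZagier2006, §3] -/
theorem cruxSeries_yyyx : cruxSeries R χ Z [true, true, true, false] =
    -cruxSeries R χ Z [false, true, true, true] := by
  have h := sum_cruxSeries_shuffle_letter χ Z true [true, true, false] 3 (by decide)
  have hw : MZV.shuffleWord [true] [true, true, false] = [[true, true, true, false],
      [true, true, true, false], [true, true, true, false], [true, true, false, true]] := by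
    decide
  rw [hw] at h
  simp only [List.map_cons, List.map_nil, List.sum_cons, List.sum_nil, add_zero,
    cruxSeries_yyxy] at h
  refine eq_of_natCast_mul_eq (n := 3) (by norm_num) ?_
  push_cast; linear_combination h

end CoeffFour

/-! ## §18b `φ(a,b)` in weight `≤ 4` for a series of the regularised shape -/

section ShapeFour

variable {k : Type} [CommRing k]

/-- **`φ(a,b)` in weight `≤ 4`** for a series whose sixteen weight-4 coefficients follow the
regularised pattern of §18a (and the Lie shape in weight `≤ 3`):
`φ(a,b) = [weight ≤ 3] + α₁[a,[a,[a,b]]] + α₃₁(aabb - 2abba - 2baab + 4baba - bbaa)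
  + α₂₂[a,b]² + α₂₁₁[[[a,b],b],b]`. [folklore] -/
theorem evalTrunc_four_of_shape {φ : NCSeries Bool k}
    (hffff : φ [false, false, false, false] = 0) (htttt : φ [true, true, true, true] = 0)
    (hfftf : φ [false, false, true, false] = -3 * φ [false, false, false, true])
    (hftff : φ [false, true, false, false] = 3 * φ [false, false, false, true])
    (htfff : φ [true, false, false, false] = -φ [false, false, false, true])
    (hfttf : φ [false, true, true, false] =
      -2 * φ [false, false, true, true] - φ [false, true, false, true])
    (htfft : φ [true, false, false, true] =
      -φ [false, true, false, true] - 2 * φ [false, false, true, true])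
    (htftf : φ [true, false, true, false] =
      φ [false, true, false, true] + 4 * φ [false, false, true, true])
    (httff : φ [true, true, false, false] = -φ [false, false, true, true])
    (htftt : φ [true, false, true, true] = -3 * φ [false, true, true, true])
    (httft : φ [true, true, false, true] = 3 * φ [false, true, true, true])
    (htttf : φ [true, true, true, false] = -φ [false, true, true, true])
    {A : Type} [Ring A] [Algebra k A] (a b : A) :
    NCSeries.evalTrunc 4 (NCSeries.bsub a b) φ = NCSeries.evalTrunc 3 (NCSeries.bsub a b) φ +
      φ [false, false, false, true] •
        (a * a * a * b - (3 : k) • (a * a * b * a) + (3 : k) • (a * b * a * a) - b * a * a * a) +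
      φ [false, false, true, true] •
        (a * a * b * b - (2 : k) • (a * b * b * a) - (2 : k) • (b * a * a * b) +
          (4 : k) • (b * a * b * a) - b * b * a * a) +
      φ [false, true, false, true] • (a * b * a * b - a * b * b * a - b * a * a * b + b * a * b * a) +
      φ [false, true, true, true] •
        (a * b * b * b - (3 : k) • (b * a * b * b) + (3 : k) • (b * b * a * b) - b * b * b * a) := by
  rw [NCSeries.evalTrunc_four_eq]
  simp only [Fintype.sum_bool, NCSeries.bsub_false, NCSeries.bsub_true, hffff, htttt, hfftf, hftff,
    htfff, hfttf, htfft, htftf, httff, htftt, httft, htttf, zero_smul, add_zero, zero_add]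
  module

end ShapeFour

/-! ## §18c The scaling endomorphisms `t_ij ↦ c · t_ij` of `U𝔞 ⊗ R/(deg > N)` -/

section Scale

open DrinfeldKohnoTrunc

variable {R : Type} [CommRing R] {ι : Type} {N : ℕ}

/-- Products of rescaled elements: `∏ (c · xᵢ) = c^{|L|} · ∏ xᵢ`. [folklore] -/
theorem prod_map_smul (c : R) : ∀ L : List (DrinfeldKohnoTrunc R ι N),
    (L.map fun x => c • x).prod = c ^ L.length • L.prod
  | [] => by simp
  | x :: L => by
    rw [List.map_cons, List.prod_cons, List.prod_cons, prod_map_smul c L, List.length_cons,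
      pow_succ, smul_mul_assoc, mul_smul_comm, smul_smul, mul_comm]

variable (R ι N) in
/-- **The scaling endomorphism** `σ_c : t_ij ↦ c · t_ij` of the truncated Drinfeld–Kohno algebra
(all defining relations are homogeneous). [folklore] -/
theorem exists_scaleHom (c : R) :
    ∃ σ : DrinfeldKohnoTrunc R ι N →ₐ[R] DrinfeldKohnoTrunc R ι N, ∀ i j, σ (t R N i j) = c • t R N i j := by
  classical
  refine ⟨RingQuot.liftAlgHom R ⟨FreeAlgebra.lift R (fun p : ι × ι => c • t R N p.1 p.2),
    fun a b hab => ?_⟩, fun i j => ?_⟩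
  · cases hab with
    | diag i => simp
    | symm i j => simp [t_symm i j]
    | fourTerm i j k hij hjk hik =>
      simp only [map_mul, map_add, FreeAlgebra.lift_ι_apply, ← smul_add, smul_mul_assoc,
        mul_smul_comm]
      rw [t_mul_add i j k hij hjk hik]
    | locality i j k l hij hik hil hjk hjl hkl =>
      simp only [map_mul, FreeAlgebra.lift_ι_apply, smul_mul_assoc, mul_smul_comm]
      rw [t_comm i j k l hij hik hil hjk hjl hkl]
    | trunc g =>
      rw [map_list_prod, map_zero, List.map_ofFn]
      have h : (List.ofFn ((fun x => c • x) ∘ fun r => t R N (g r).1 (g r).2)).prod = 0 := by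
        rw [← List.map_ofFn, prod_map_smul, prod_t_eq_zero, smul_zero]
      simpa [Function.comp_def] using h
  · exact (RingQuot.liftAlgHom_mkAlgHom_apply R _ _ _).trans (FreeAlgebra.lift_ι_apply _ _)

end Scale

end Pending18abc_WeightFourShape

section Pending16gh_Duality
open MeasureTheory Set

open Summit.KontsevichZagierPeriods.KontsevichZagierPeriods.Theses.FurushoPentagon (PentagonInKZ)

/-! ## §16g The duality involution of the ordered simplex -/

/-- The duality involution `t ↦ (1 - t_{n-1-j})_j` of `ℝⁿ`. [cite: Zagier1994, §9] -/
def dualMap (n : ℕ) (t : Fin n → ℝ) : Fin n → ℝ := fun j => 1 - t (Fin.rev j)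

/-- Its linear part `v ↦ (-v_{n-1-j})_j`. [folklore] -/
def dualLin (n : ℕ) : (Fin n → ℝ) →L[ℝ] (Fin n → ℝ) :=
  -ContinuousLinearMap.pi fun j => ContinuousLinearMap.proj (Fin.rev j)

/-- `dualLin v = (-v_{rev j})_j`. [folklore] -/
theorem dualLin_apply (n : ℕ) (v : Fin n → ℝ) : dualLin n v = fun j => -v (Fin.rev j) := by
  ext j; simp [dualLin]

/-- `dualMap` is an involution. [cite: Zagier1994, §9] -/
theorem dualMap_dualMap (n : ℕ) (t : Fin n → ℝ) : dualMap n (dualMap n t) = t := by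
  ext j; simp [dualMap, Fin.rev_rev]

/-- `dualMap = 1 + dualLin`. [folklore] -/
theorem dualMap_eq (n : ℕ) (t : Fin n → ℝ) : dualMap n t = (fun _ => (1 : ℝ)) + dualLin n t := by
  ext j; simp [dualMap, dualLin_apply, sub_eq_add_neg]

/-- `dualMap` is differentiable with derivative `dualLin`. [folklore] -/
theorem hasFDerivAt_dualMap (n : ℕ) (t : Fin n → ℝ) : HasFDerivAt (dualMap n) (dualLin n) t := by
  have h : dualMap n = fun s => (fun _ => (1 : ℝ)) + dualLin n s := funext (dualMap_eq n)
  rw [h]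
  exact ((dualLin n).hasFDerivAt).const_add _

/-- `|det dualLin| = 1` (an involution). [folklore] -/
theorem abs_det_dualLin (n : ℕ) : |(dualLin n).det| = 1 := by
  have hcomp : (dualLin n : (Fin n → ℝ) →ₗ[ℝ] (Fin n → ℝ)) ∘ₗ (dualLin n : (Fin n → ℝ) →ₗ[ℝ] (Fin n → ℝ)) =
      LinearMap.id := by
    refine LinearMap.ext fun v => ?_
    have h1 : dualLin n (dualLin n v) = v := by
      rw [dualLin_apply, dualLin_apply]
      ext j; simp [Fin.rev_rev]
    simpa using h1
  have hdet : (dualLin n).det * (dualLin n).det = 1 := by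
    rw [ContinuousLinearMap.det, ← LinearMap.det_comp, hcomp, LinearMap.det_id]
  rcases mul_self_eq_one_iff.mp hdet with h | h
  · rw [h, abs_one]
  · rw [h, abs_neg, abs_one]

/-- `dualMap` preserves the open ordered simplex. [cite: Zagier1994, §9] -/
theorem dualMap_mem_openOrderedSimplex {n : ℕ} {t : Fin n → ℝ} (ht : t ∈ KZ.openOrderedSimplex n) :
    dualMap n t ∈ KZ.openOrderedSimplex n := by
  obtain ⟨h0, h1, hanti⟩ := ht
  refine ⟨fun i => ?_, fun i => ?_, fun i j hij => ?_⟩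
  · simp only [dualMap]; linarith [h1 (Fin.rev i)]
  · simp only [dualMap]; linarith [h0 (Fin.rev i)]
  · simp only [dualMap]
    have hr : Fin.rev j < Fin.rev i := Fin.rev_lt_rev.mpr hij
    linarith [hanti hr]

/-- The image of the simplex under `dualMap` is the simplex. [cite: Zagier1994, §9] -/
theorem image_dualMap (n : ℕ) : dualMap n '' KZ.openOrderedSimplex n = KZ.openOrderedSimplex n := by
  ext t
  constructor
  · rintro ⟨s, hs, rfl⟩
    exact dualMap_mem_openOrderedSimplex hs
  · intro ht
    exact ⟨dualMap n t, dualMap_mem_openOrderedSimplex ht, dualMap_dualMap n t⟩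

/-- `dualMap` is a `ℚ`-polynomial, hence `ℚ`-semialgebraic, map on the simplex. [cite: BCR1998, §2.2] -/
theorem isSemialgebraicMapOn_dualMap (n : ℕ) :
    IsSemialgebraicMapOn ℚ (KZ.openOrderedSimplex n) (dualMap n) := by
  have h : dualMap n = fun x j =>
      MvPolynomial.aeval x ((1 : MvPolynomial (Fin n) ℚ) - MvPolynomial.X (Fin.rev j)) := by
    funext x j; simp [dualMap]
  rw [h]
  exact isSemialgebraicMapOn_aeval (KZ.isSemialgebraic_openOrderedSimplex n) _

/-- The integrand identity `ω₀(t₀)ω₀(t₁)ω₁(t₂) = (ω₀ω₁ω₁)(1-t₂,1-t₁,1-t₀)`. [cite: Zagier1994, §9] -/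
theorem mzvIntegrand_three_eq (t : Fin 3 → ℝ) :
    KZ.mzvIntegrand [3] t = KZ.mzvIntegrand [2, 1] (dualMap 3 t) := by
  have hw3 : MZV.binaryWord [3] = [false, false, true] := by decide
  have hw21 : MZV.binaryWord [2, 1] = [false, true, true] := by decide
  have r0 : Fin.rev (0 : Fin 3) = 2 := by decide
  have r1 : Fin.rev (1 : Fin 3) = 1 := by decide
  have r2 : Fin.rev (2 : Fin 3) = 0 := by decide
  unfold KZ.mzvIntegrand
  rw [hw3, hw21]
  show (∏ i : Fin 3, KZ.mzvForm ([false, false, true].getD i false) (t i)) =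
    ∏ i : Fin 3, KZ.mzvForm ([false, true, true].getD i false) (1 - t (Fin.rev i))
  simp only [Fin.prod_univ_three, r0, r1, r2]
  simp [KZ.mzvForm]
  ring

/-- **EULER'S `ζ(3) = ζ(2,1)` IS ONE MOVE**: the simplex representations of `ζ(3)` and `ζ(2,1)`
differ by a single change of variables (rule 2) along the duality involution
`t ↦ (1 - t₂, 1 - t₁, 1 - t₀)` — the instance `s = (3)` of the support item `DualityInKZ`.
[cite: Zagier1994, §9; KontsevichZagier2001, §1.2 rule (2)] -/
theorem mzvRep_three_sub_twoOne_mem_relations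
    (a : IsSemialgebraicFunOn ℚ (KZ.openOrderedSimplex (MZV.weight [3])) (KZ.mzvIntegrand [3]))
    (b : IntegrableOn (KZ.mzvIntegrand [3]) (KZ.openOrderedSimplex (MZV.weight [3])) volume)
    (a' : IsSemialgebraicFunOn ℚ (KZ.openOrderedSimplex (MZV.weight [2, 1])) (KZ.mzvIntegrand [2, 1]))
    (b' : IntegrableOn (KZ.mzvIntegrand [2, 1]) (KZ.openOrderedSimplex (MZV.weight [2, 1])) volume) :
    KZ.of (KZ.mzvRep [3] (by decide) a b) - KZ.of (KZ.mzvRep [2, 1] (by decide) a' b') ∈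
      KZ.relations := by
  refine KZ.changeOfVariablesRel_subset_relations ⟨MZV.weight [3], KZ.mzvRep [3] (by decide) a b,
    KZ.mzvRep [2, 1] (by decide) a' b', dualMap _, fun _ => dualLin _, ?_, ?_, ?_, ?_, ?_, rfl⟩
  · rw [KZ.mzvRep_domain]
    exact isSemialgebraicMapOn_dualMap _
  · intro x _
    exact (hasFDerivAt_dualMap _ x).hasFDerivWithinAt
  · intro x _ y _ hxy
    rw [← dualMap_dualMap _ x, hxy, dualMap_dualMap]
  · rw [KZ.mzvRep_domain, KZ.mzvRep_domain]
    exact (image_dualMap _).symm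
  · intro t _
    rw [abs_det_dualLin, mul_one]
    exact mzvIntegrand_three_eq t

/-! ## §16h Unconditional tightness modulo weight 4 -/

section Unconditional

variable {R : Type} [CommRing R] [Algebra ℚ R] {χ : KZ.FormalRep →+ R} {Z : List ℕ → KZ.FormalRep}

omit [Algebra ℚ R] in
/-- **`χ⟦ζ(3)⟧ = χ⟦ζ(2,1)⟧` in EVERY realisation of the rules** (one change of variables).
[cite: Zagier1994, §9] -/
theorem chi_Z3_eq_Z21 (hχ : IsRealisation R χ) (hZ : AgreesWithSimplex Z) :
    χ (Z [3]) = χ (Z [2, 1]) := by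
  have h := hχ.rel _ (mzvRep_three_sub_twoOne_mem_relations
    (KZ.mzvIntegrand_isSemialgebraicFunOn_holds [3]) (KZ.mzvIntegrand_integrableOn_holds [3] (by decide))
    (KZ.mzvIntegrand_isSemialgebraicFunOn_holds [2, 1])
    (KZ.mzvIntegrand_integrableOn_holds [2, 1] (by decide)))
  rw [map_sub, sub_eq_zero] at h
  rw [hZ [3] (by decide), hZ [2, 1] (by decide)]
  exact h

/-- **THE CRUX HOLDS UNCONDITIONALLY MODULO WEIGHT 4**: for every realisation `χ` of the rules and
every agreeing `Z`, `Φ_χ` satisfies Drinfeld's pentagon identity in `U𝔞₄ ⊗ R/(deg > N)` for all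
`N ≤ 3`.  (Level `≤ 2`: regularisation + locality, gen. 2; level 3: Lie shape + `D[K₂] = 0` +
`D[U] = D[V]` + the duality move.)  A refutation of `PentagonInKZ` must therefore live in weight
`≥ 4`. [cite: Furusho2011, §2] -/
theorem pentAt_le_three (hχ : IsRealisation R χ) (hZ : AgreesWithSimplex Z) :
    ∀ N ≤ 3, NCSeries.PentAt (cruxSeries R χ Z) N :=
  pentAt_le_three_of_duality hχ hZ (chi_Z3_eq_Z21 hχ hZ)

/-- In particular the rules associator's pentagon defect starts in weight `≥ 4`: stated for the
crux's own quantifier shape. [cite: Furusho2011, §2] -/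
theorem pentagonInKZ_mod_weight_four :
    ∀ (R : Type) [CommRing R] [Algebra ℚ R] (χ : KZ.FormalRep →+ R),
      (∀ c ∈ KZ.relations, χ c = 0) → (∀ a b, χ (a * b) = χ a * χ b) → (∃ u, χ u = 1) →
      ∀ Z : List ℕ → KZ.FormalRep, AgreesWithSimplex Z →
        ∀ N ≤ 3, NCSeries.PentAt (cruxSeries R χ Z) N :=
  fun R _ _ _ h1 h2 h3 _ hZ => pentAt_le_three (R := R) ⟨h1, h2, h3⟩ hZ

end Unconditional

end Pending16gh_Duality

section Pending18d_WeightFourLinear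

open Summit.KontsevichZagierPeriods.KontsevichZagierPeriods.Theses.FurushoPentagon (PentagonInKZ)

/-! ## §18d The weight-4 elements and the linearised level-4 identity -/

section DK4

open DrinfeldKohnoTrunc

variable {R : Type} [CommRing R] {N : ℕ}

/-- `[A,[A,[A,B]]] = AAAB - 3AABA + 3ABAA - BAAA`. [folklore] -/
def KL1 (A B : DrinfeldKohnoTrunc R (Fin 4) N) : DrinfeldKohnoTrunc R (Fin 4) N :=
  A * A * A * B - (3 : R) • (A * A * B * A) + (3 : R) • (A * B * A * A) - B * A * A * A

/-- The `α₃₁`-pattern `AABB - 2ABBA - 2BAAB + 4BABA - BBAA`. [folklore] -/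
def K31 (A B : DrinfeldKohnoTrunc R (Fin 4) N) : DrinfeldKohnoTrunc R (Fin 4) N :=
  A * A * B * B - (2 : R) • (A * B * B * A) - (2 : R) • (B * A * A * B) + (4 : R) • (B * A * B * A) -
    B * B * A * A

/-- `[A,B]² = ABAB - ABBA - BAAB + BABA`. [folklore] -/
def K22 (A B : DrinfeldKohnoTrunc R (Fin 4) N) : DrinfeldKohnoTrunc R (Fin 4) N :=
  A * B * A * B - A * B * B * A - B * A * A * B + B * A * B * A

/-- `[[[A,B],B],B] = ABBB - 3BABB + 3BBAB - BBBA`. [folklore] -/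
def KL3 (A B : DrinfeldKohnoTrunc R (Fin 4) N) : DrinfeldKohnoTrunc R (Fin 4) N :=
  A * B * B * B - (3 : R) • (B * A * B * B) + (3 : R) • (B * B * A * B) - B * B * B * A

variable (R N) in
/-- **The quadratic cross term of the level-4 pentagon identity**:
`X = K₂¹K₂² - K₂³K₂⁴ - K₂³K₂⁵ - K₂⁴K₂⁵` (`K₂ⁱ = [Aᵢ,Bᵢ]` for the five substitutions). [cite: BarNatan1998, §3] -/
def pentX : DrinfeldKohnoTrunc R (Fin 4) N :=
  K₂ (t R N 0 1) (t R N 1 2 + t R N 1 3) * K₂ (t R N 0 2 + t R N 1 2) (t R N 2 3) -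
    K₂ (t R N 1 2) (t R N 2 3) * K₂ (t R N 0 1 + t R N 0 2) (t R N 1 3 + t R N 2 3) -
    K₂ (t R N 1 2) (t R N 2 3) * K₂ (t R N 0 1) (t R N 1 2) -
    K₂ (t R N 0 1 + t R N 0 2) (t R N 1 3 + t R N 2 3) * K₂ (t R N 0 1) (t R N 1 2)

/-- Products of three weight-one elements have weight `≥ 3`. [folklore] -/
theorem mul_mul_mem_wFil_three {X Y W : DrinfeldKohnoTrunc R (Fin 4) N}
    (hX : X ∈ (wFil 1 : Submodule R (DrinfeldKohnoTrunc R (Fin 4) N)))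
    (hY : Y ∈ (wFil 1 : Submodule R (DrinfeldKohnoTrunc R (Fin 4) N)))
    (hW : W ∈ (wFil 1 : Submodule R (DrinfeldKohnoTrunc R (Fin 4) N))) :
    X * Y * W ∈ (wFil 3 : Submodule R (DrinfeldKohnoTrunc R (Fin 4) N)) := by
  have h3 := mul_mem_wFil (mul_mem_wFil hX hY) hW
  exact h3

/-- Products of four weight-one elements have weight `≥ 3`. [folklore] -/
theorem mul_mul_mul_mem_wFil_three {X Y W V : DrinfeldKohnoTrunc R (Fin 4) N}
    (hX : X ∈ (wFil 1 : Submodule R (DrinfeldKohnoTrunc R (Fin 4) N)))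
    (hY : Y ∈ (wFil 1 : Submodule R (DrinfeldKohnoTrunc R (Fin 4) N)))
    (hW : W ∈ (wFil 1 : Submodule R (DrinfeldKohnoTrunc R (Fin 4) N)))
    (hV : V ∈ (wFil 1 : Submodule R (DrinfeldKohnoTrunc R (Fin 4) N))) :
    X * Y * W * V ∈ (wFil 3 : Submodule R (DrinfeldKohnoTrunc R (Fin 4) N)) := by
  have h4 := mul_mem_wFil (mul_mem_wFil (mul_mem_wFil hX hY) hW) hV
  exact wFil_antitone (m := 3) (n := 1 + 1 + 1 + 1) (by norm_num) h4

/-- The higher part `p·U + q·V + α₁L₁ + α₃₁W₃₁ + α₂₂K₂² + α₂₁₁L₃` of weight-one `A, B` has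
weight `≥ 3`. [folklore] -/
theorem higher_mem_wFil_three (p q a1 a31 a22 a211 : R) {A B : DrinfeldKohnoTrunc R (Fin 4) N}
    (hA : A ∈ (wFil 1 : Submodule R (DrinfeldKohnoTrunc R (Fin 4) N)))
    (hB : B ∈ (wFil 1 : Submodule R (DrinfeldKohnoTrunc R (Fin 4) N))) :
    p • KU A B + q • KV A B + a1 • KL1 A B + a31 • K31 A B + a22 • K22 A B + a211 • KL3 A B ∈
      (wFil 3 : Submodule R (DrinfeldKohnoTrunc R (Fin 4) N)) := by
  have m3 := fun {X Y W : DrinfeldKohnoTrunc R (Fin 4) N}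
    (hX : X ∈ (wFil 1 : Submodule R (DrinfeldKohnoTrunc R (Fin 4) N)))
    (hY : Y ∈ (wFil 1 : Submodule R (DrinfeldKohnoTrunc R (Fin 4) N)))
    (hW : W ∈ (wFil 1 : Submodule R (DrinfeldKohnoTrunc R (Fin 4) N))) => mul_mul_mem_wFil_three hX hY hW
  have m4 := fun {X Y W V : DrinfeldKohnoTrunc R (Fin 4) N}
    (hX : X ∈ (wFil 1 : Submodule R (DrinfeldKohnoTrunc R (Fin 4) N)))
    (hY : Y ∈ (wFil 1 : Submodule R (DrinfeldKohnoTrunc R (Fin 4) N)))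
    (hW : W ∈ (wFil 1 : Submodule R (DrinfeldKohnoTrunc R (Fin 4) N)))
    (hV : V ∈ (wFil 1 : Submodule R (DrinfeldKohnoTrunc R (Fin 4) N))) =>
    mul_mul_mul_mem_wFil_three hX hY hW hV
  simp only [KU, KV, KL1, K31, K22, KL3]
  refine Submodule.add_mem _ (Submodule.add_mem _ (Submodule.add_mem _ (Submodule.add_mem _
    (Submodule.add_mem _ (Submodule.smul_mem _ _ ?_) (Submodule.smul_mem _ _ ?_))
    (Submodule.smul_mem _ _ ?_)) (Submodule.smul_mem _ _ ?_)) (Submodule.smul_mem _ _ ?_))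
    (Submodule.smul_mem _ _ ?_)
  · exact Submodule.add_mem _ (Submodule.sub_mem _ (Submodule.sub_mem _ (m3 hA hA hB) (m3 hA hB hA))
      (m3 hA hB hA)) (m3 hB hA hA)
  · exact Submodule.add_mem _ (Submodule.sub_mem _ (Submodule.sub_mem _ (m3 hA hB hB) (m3 hB hA hB))
      (m3 hB hA hB)) (m3 hB hB hA)
  · exact Submodule.sub_mem _ (Submodule.add_mem _ (Submodule.sub_mem _ (m4 hA hA hA hB)
      (Submodule.smul_mem _ _ (m4 hA hA hB hA))) (Submodule.smul_mem _ _ (m4 hA hB hA hA))) (m4 hB hA hA hA)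
  · exact Submodule.sub_mem _ (Submodule.add_mem _ (Submodule.sub_mem _ (Submodule.sub_mem _ (m4 hA hA hB hB)
      (Submodule.smul_mem _ _ (m4 hA hB hB hA))) (Submodule.smul_mem _ _ (m4 hB hA hA hB)))
      (Submodule.smul_mem _ _ (m4 hB hA hB hA))) (m4 hB hB hA hA)
  · exact Submodule.add_mem _ (Submodule.sub_mem _ (Submodule.sub_mem _ (m4 hA hB hA hB) (m4 hA hB hB hA))
      (m4 hB hA hA hB)) (m4 hB hA hB hA)
  · exact Submodule.sub_mem _ (Submodule.add_mem _ (Submodule.sub_mem _ (m4 hA hB hB hB)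
      (Submodule.smul_mem _ _ (m4 hB hA hB hB))) (Submodule.smul_mem _ _ (m4 hB hB hA hB))) (m4 hB hB hB hA)

/-- `(1 + cK + r)(1 + cK' + r') = 1 + (cK + r) + (cK' + r') + c²KK'` at level `4`
for `K, K'` of weight `≥ 2` and `r, r'` of weight `≥ 3`. [folklore] -/
theorem one_add_mul_one_add_four (c : R) {K K' r r' : DrinfeldKohnoTrunc R (Fin 4) 4}
    (hK : K ∈ (wFil 2 : Submodule R (DrinfeldKohnoTrunc R (Fin 4) 4)))
    (hK' : K' ∈ (wFil 2 : Submodule R (DrinfeldKohnoTrunc R (Fin 4) 4)))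
    (hr : r ∈ (wFil 3 : Submodule R (DrinfeldKohnoTrunc R (Fin 4) 4)))
    (hr' : r' ∈ (wFil 3 : Submodule R (DrinfeldKohnoTrunc R (Fin 4) 4))) :
    (1 + (c • K + r)) * (1 + (c • K' + r')) =
      1 + ((c • K + r) + (c • K' + r')) + (c * c) • (K * K') := by
  have z1 : K * r' = 0 := mul_eq_zero_of_wFil (show 4 < 2 + 3 by norm_num) hK hr'
  have z2 : r * K' = 0 := mul_eq_zero_of_wFil (show 4 < 3 + 2 by norm_num) hr hK'
  have z3 : r * r' = 0 := mul_eq_zero_of_wFil (show 4 < 3 + 3 by norm_num) hr hr'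
  have e : (1 + (c • K + r)) * (1 + (c • K' + r')) = 1 + ((c • K + r) + (c • K' + r')) +
      ((c * c) • (K * K') + c • (K * r') + c • (r * K') + r * r') := by
    simp only [mul_add, add_mul, one_mul, mul_one, smul_mul_assoc, mul_smul_comm, smul_smul, smul_add]
    abel
  rw [e, z1, z2, z3]
  simp only [smul_zero, add_zero]

/-- The element `(cK + r) + (cK' + r') + c²KK'` has weight `≥ 2`. [folklore] -/
theorem sum_mem_wFil_two (c : R) {K K' r r' : DrinfeldKohnoTrunc R (Fin 4) 4}
    (hK : K ∈ (wFil 2 : Submodule R (DrinfeldKohnoTrunc R (Fin 4) 4)))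
    (hK' : K' ∈ (wFil 2 : Submodule R (DrinfeldKohnoTrunc R (Fin 4) 4)))
    (hr : r ∈ (wFil 3 : Submodule R (DrinfeldKohnoTrunc R (Fin 4) 4)))
    (hr' : r' ∈ (wFil 3 : Submodule R (DrinfeldKohnoTrunc R (Fin 4) 4))) :
    ((c • K + r) + (c • K' + r')) + (c * c) • (K * K') ∈
      (wFil 2 : Submodule R (DrinfeldKohnoTrunc R (Fin 4) 4)) := by
  have hr2 : r ∈ (wFil 2 : Submodule R (DrinfeldKohnoTrunc R (Fin 4) 4)) := wFil_antitone (by norm_num) hr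
  have hr2' : r' ∈ (wFil 2 : Submodule R (DrinfeldKohnoTrunc R (Fin 4) 4)) := wFil_antitone (by norm_num) hr'
  have hKK : K * K' ∈ (wFil 2 : Submodule R (DrinfeldKohnoTrunc R (Fin 4) 4)) := by
    have h := mul_mem_wFil hK hK'
    exact wFil_antitone (m := 2) (n := 2 + 2) (by norm_num) h
  exact Submodule.add_mem _ (Submodule.add_mem _ (Submodule.add_mem _ (Submodule.smul_mem _ _ hK) hr2)
    (Submodule.add_mem _ (Submodule.smul_mem _ _ hK') hr2')) (Submodule.smul_mem _ _ hKK)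

/-- `(1 + w)(1 + cK + r) = 1 + w + (cK + r) + c·(the weight-2 part of w)·K …` specialised:
for `w = (cK₃ + r₃) + (cK₄ + r₄) + c²K₃K₄`, `(1 + w)(1 + cK₅ + r₅) = 1 + w + (cK₅ + r₅) +
c²(K₃K₅ + K₄K₅)` at level `4`. [folklore] -/
theorem one_add_mul_third (c : R) {K₃ K₄ K₅ r₃ r₄ r₅ : DrinfeldKohnoTrunc R (Fin 4) 4}
    (hK₃ : K₃ ∈ (wFil 2 : Submodule R (DrinfeldKohnoTrunc R (Fin 4) 4)))
    (hK₄ : K₄ ∈ (wFil 2 : Submodule R (DrinfeldKohnoTrunc R (Fin 4) 4)))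
    (hK₅ : K₅ ∈ (wFil 2 : Submodule R (DrinfeldKohnoTrunc R (Fin 4) 4)))
    (hr₃ : r₃ ∈ (wFil 3 : Submodule R (DrinfeldKohnoTrunc R (Fin 4) 4)))
    (hr₄ : r₄ ∈ (wFil 3 : Submodule R (DrinfeldKohnoTrunc R (Fin 4) 4)))
    (hr₅ : r₅ ∈ (wFil 3 : Submodule R (DrinfeldKohnoTrunc R (Fin 4) 4))) :
    (1 + ((c • K₃ + r₃) + (c • K₄ + r₄)) + (c * c) • (K₃ * K₄)) * (1 + (c • K₅ + r₅)) =
      1 + ((c • K₃ + r₃) + (c • K₄ + r₄) + (c • K₅ + r₅)) +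
        (c * c) • (K₃ * K₄ + K₃ * K₅ + K₄ * K₅) := by
  have z35 : K₃ * r₅ = 0 := mul_eq_zero_of_wFil (show 4 < 2 + 3 by norm_num) hK₃ hr₅
  have z45 : K₄ * r₅ = 0 := mul_eq_zero_of_wFil (show 4 < 2 + 3 by norm_num) hK₄ hr₅
  have zr3K : r₃ * K₅ = 0 := mul_eq_zero_of_wFil (show 4 < 3 + 2 by norm_num) hr₃ hK₅
  have zr4K : r₄ * K₅ = 0 := mul_eq_zero_of_wFil (show 4 < 3 + 2 by norm_num) hr₄ hK₅
  have zr3r : r₃ * r₅ = 0 := mul_eq_zero_of_wFil (show 4 < 3 + 3 by norm_num) hr₃ hr₅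
  have zr4r : r₄ * r₅ = 0 := mul_eq_zero_of_wFil (show 4 < 3 + 3 by norm_num) hr₄ hr₅
  have zKKK : K₃ * K₄ * K₅ = 0 :=
    mul_eq_zero_of_wFil (show 4 < (2 + 2) + 2 by norm_num) (mul_mem_wFil hK₃ hK₄) hK₅
  have zKKr : K₃ * K₄ * r₅ = 0 :=
    mul_eq_zero_of_wFil (show 4 < (2 + 2) + 3 by norm_num) (mul_mem_wFil hK₃ hK₄) hr₅
  have e : (1 + ((c • K₃ + r₃) + (c • K₄ + r₄)) + (c * c) • (K₃ * K₄)) * (1 + (c • K₅ + r₅)) =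
      1 + ((c • K₃ + r₃) + (c • K₄ + r₄) + (c • K₅ + r₅)) +
        ((c * c) • (K₃ * K₄ + K₃ * K₅ + K₄ * K₅) + (c • (K₃ * r₅) + c • (K₄ * r₅) + c • (r₃ * K₅) +
          c • (r₄ * K₅) + r₃ * r₅ + r₄ * r₅ + (c * c * c) • (K₃ * K₄ * K₅) +
          (c * c) • (K₃ * K₄ * r₅))) := by
    simp only [mul_add, add_mul, one_mul, mul_one, smul_mul_assoc, mul_smul_comm, smul_smul, smul_add,
      mul_assoc]
    abel
  rw [e, z35, z45, zr3K, zr4K, zr3r, zr4r, zKKK, zKKr]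
  simp only [smul_zero, add_zero]

end DK4

/-! ### The linearised level-4 identity -/

section Level4

open DrinfeldKohnoTrunc

variable {R : Type} [CommRing R]

/-- **The level-4 pentagon identity for a series of regularised shape in weight `≤ 4`**:
`PentAt φ 4 ↔ c·D[K₂] + p·D[U] + q·D[V] + α₁·D[L₁] + α₃₁·D[W₃₁] + α₂₂·D[K₂²] + α₂₁₁·D[L₃] + c²·X = 0`
in `U𝔞₄ ⊗ R/(deg > 4)`. [cite: BarNatan1998, §3 (linearised pentagon)] -/
theorem pentAt_four_iff_of_shape {φ : NCSeries Bool R} (hφ : φ [] = 1) (h0 : φ [false] = 0)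
    (h1 : φ [true] = 0) (hff : φ [false, false] = 0) (htt : φ [true, true] = 0)
    (htf : φ [true, false] = -φ [false, true]) (hfff : φ [false, false, false] = 0)
    (httt : φ [true, true, true] = 0) (hftf : φ [false, true, false] = -2 * φ [false, false, true])
    (htff : φ [true, false, false] = φ [false, false, true])
    (htft : φ [true, false, true] = -2 * φ [false, true, true])
    (httf : φ [true, true, false] = φ [false, true, true])
    (hffff : φ [false, false, false, false] = 0) (htttt : φ [true, true, true, true] = 0)
    (hfftf : φ [false, false, true, false] = -3 * φ [false, false, false, true])
    (hftff : φ [false, true, false, false] = 3 * φ [false, false, false, true])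
    (htfff : φ [true, false, false, false] = -φ [false, false, false, true])
    (hfttf : φ [false, true, true, false] =
      -2 * φ [false, false, true, true] - φ [false, true, false, true])
    (htfft : φ [true, false, false, true] =
      -φ [false, true, false, true] - 2 * φ [false, false, true, true])
    (htftf : φ [true, false, true, false] =
      φ [false, true, false, true] + 4 * φ [false, false, true, true])
    (httff : φ [true, true, false, false] = -φ [false, false, true, true])
    (htftt : φ [true, false, true, true] = -3 * φ [false, true, true, true])
    (httft : φ [true, true, false, true] = 3 * φ [false, true, true, true])
    (htttf : φ [true, true, true, false] = -φ [false, true, true, true]) :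
    NCSeries.PentAt φ 4 ↔
      φ [false, true] • pentD R 4 K₂ + φ [false, false, true] • pentD R 4 KU +
        φ [false, true, true] • pentD R 4 KV + φ [false, false, false, true] • pentD R 4 KL1 +
        φ [false, false, true, true] • pentD R 4 K31 + φ [false, true, false, true] • pentD R 4 K22 +
        φ [false, true, true, true] • pentD R 4 KL3 + (φ [false, true] * φ [false, true]) • pentX R 4 = 0 := by
  -- abbreviations for the seven coefficients
  set c := φ [false, true] with hc
  set p := φ [false, false, true] with hp
  set q := φ [false, true, true] with hq
  set a1 := φ [false, false, false, true] with ha1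
  set a31 := φ [false, false, true, true] with ha31
  set a22 := φ [false, true, false, true] with ha22
  set a211 := φ [false, true, true, true] with ha211
  -- the expansion of one factor
  have hexp : ∀ A B : DrinfeldKohnoTrunc R (Fin 4) 4, NCSeries.evalTrunc 4 (NCSeries.bsub A B) φ =
      1 + (c • K₂ A B + (p • KU A B + q • KV A B + a1 • KL1 A B + a31 • K31 A B + a22 • K22 A B +
        a211 • KL3 A B)) := fun A B => by
    rw [evalTrunc_four_of_shape hffff htttt hfftf hftff htfff hfttf htfft htftf httff htftt httft htttf,
      evalTrunc_three_of_shape hφ h0 h1 hff htt htf hfff httt hftf htff htft httf, K₂, KU, KV, KL1, K31,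
      K22, KL3]
    module
  have hg : ∀ i j : Fin 4, t R 4 i j ∈ (wFil 1 : Submodule R (DrinfeldKohnoTrunc R (Fin 4) 4)) :=
    t_mem_wFil_one'
  have hadd : ∀ {A B : DrinfeldKohnoTrunc R (Fin 4) 4},
      A ∈ (wFil 1 : Submodule R (DrinfeldKohnoTrunc R (Fin 4) 4)) →
      B ∈ (wFil 1 : Submodule R (DrinfeldKohnoTrunc R (Fin 4) 4)) →
      A + B ∈ (wFil 1 : Submodule R (DrinfeldKohnoTrunc R (Fin 4) 4)) := fun hA hB =>
    Submodule.add_mem _ hA hB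
  have hK : ∀ {A B : DrinfeldKohnoTrunc R (Fin 4) 4},
      A ∈ (wFil 1 : Submodule R (DrinfeldKohnoTrunc R (Fin 4) 4)) →
      B ∈ (wFil 1 : Submodule R (DrinfeldKohnoTrunc R (Fin 4) 4)) →
      K₂ A B ∈ (wFil 2 : Submodule R (DrinfeldKohnoTrunc R (Fin 4) 4)) := fun hA hB =>
    Submodule.sub_mem _ (mul_mem_wFil_two' hA hB) (mul_mem_wFil_two' hB hA)
  have hr := fun {A B : DrinfeldKohnoTrunc R (Fin 4) 4}
      (hA : A ∈ (wFil 1 : Submodule R (DrinfeldKohnoTrunc R (Fin 4) 4)))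
      (hB : B ∈ (wFil 1 : Submodule R (DrinfeldKohnoTrunc R (Fin 4) 4))) =>
    higher_mem_wFil_three p q a1 a31 a22 a211 hA hB
  -- the five pairs
  have hA1 := hg 0 1
  have hB1 := hadd (hg 1 2) (hg 1 3)
  have hA2 := hadd (hg 0 2) (hg 1 2)
  have hB2 := hg 2 3
  have hA3 := hg 1 2
  have hB3 := hg 2 3
  have hA4 := hadd (hg 0 1) (hg 0 2)
  have hB4 := hadd (hg 1 3) (hg 2 3)
  have hA5 := hg 0 1
  have hB5 := hg 1 2
  dsimp only [NCSeries.PentAt, NCSeries.subst₂, NCSeries.t₄]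
  rw [hexp, hexp, hexp, hexp, hexp,
    one_add_mul_one_add_four c (hK hA1 hB1) (hK hA2 hB2) (hr hA1 hB1) (hr hA2 hB2),
    one_add_mul_one_add_four c (hK hA3 hB3) (hK hA4 hB4) (hr hA3 hB3) (hr hA4 hB4),
    one_add_mul_third c (hK hA3 hB3) (hK hA4 hB4) (hK hA5 hB5) (hr hA3 hB3) (hr hA4 hB4) (hr hA5 hB5),
    ← sub_eq_zero]
  refine Eq.congr_left ?_
  simp only [pentD, pentX, smul_add, smul_sub]
  abel

/-! ## §18e The universal identities among the level-4 elements -/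

/-- Naturality of `L₁` under algebra maps. [folklore] -/
theorem map_KL1 {N : ℕ} (σ : DrinfeldKohnoTrunc R (Fin 4) N →ₐ[R] DrinfeldKohnoTrunc R (Fin 4) N)
    (A B : DrinfeldKohnoTrunc R (Fin 4) N) : σ (KL1 A B) = KL1 (σ A) (σ B) := by
  simp only [KL1, map_sub, map_add, map_mul, _root_.map_smul]

/-- Naturality of `W₃₁` under algebra maps. [folklore] -/
theorem map_K31 {N : ℕ} (σ : DrinfeldKohnoTrunc R (Fin 4) N →ₐ[R] DrinfeldKohnoTrunc R (Fin 4) N)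
    (A B : DrinfeldKohnoTrunc R (Fin 4) N) : σ (K31 A B) = K31 (σ A) (σ B) := by
  simp only [K31, map_sub, map_add, map_mul, _root_.map_smul]

/-- Naturality of `K₂²` under algebra maps. [folklore] -/
theorem map_K22 {N : ℕ} (σ : DrinfeldKohnoTrunc R (Fin 4) N →ₐ[R] DrinfeldKohnoTrunc R (Fin 4) N)
    (A B : DrinfeldKohnoTrunc R (Fin 4) N) : σ (K22 A B) = K22 (σ A) (σ B) := by
  simp only [K22, map_sub, map_add, map_mul]

/-- Naturality of `L₃` under algebra maps. [folklore] -/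
theorem map_KL3 {N : ℕ} (σ : DrinfeldKohnoTrunc R (Fin 4) N →ₐ[R] DrinfeldKohnoTrunc R (Fin 4) N)
    (A B : DrinfeldKohnoTrunc R (Fin 4) N) : σ (KL3 A B) = KL3 (σ A) (σ B) := by
  simp only [KL3, map_sub, map_add, map_mul, _root_.map_smul]

/-- Naturality of `U`, `V`, `K₂` under algebra maps. [folklore] -/
theorem map_KU' {N : ℕ} (σ : DrinfeldKohnoTrunc R (Fin 4) N →ₐ[R] DrinfeldKohnoTrunc R (Fin 4) N)
    (A B : DrinfeldKohnoTrunc R (Fin 4) N) : σ (KU A B) = KU (σ A) (σ B) ∧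
      σ (KV A B) = KV (σ A) (σ B) ∧ σ (K₂ A B) = K₂ (σ A) (σ B) := by
  refine ⟨?_, ?_, ?_⟩ <;> simp only [KU, KV, K₂, map_sub, map_add, map_mul]

/-- Homogeneity of the weight-3 and weight-4 patterns. [folklore] -/
theorem smul_patterns {N : ℕ} (c : R) (A B : DrinfeldKohnoTrunc R (Fin 4) N) :
    K₂ (c • A) (c • B) = (c * c) • K₂ A B ∧ KU (c • A) (c • B) = (c * c * c) • KU A B ∧
      KV (c • A) (c • B) = (c * c * c) • KV A B ∧ KL1 (c • A) (c • B) = (c * c * c * c) • KL1 A B ∧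
      K31 (c • A) (c • B) = (c * c * c * c) • K31 A B ∧ K22 (c • A) (c • B) = (c * c * c * c) • K22 A B ∧
      KL3 (c • A) (c • B) = (c * c * c * c) • KL3 A B := by
  refine ⟨?_, ?_, ?_, ?_, ?_, ?_, ?_⟩ <;>
    simp only [K₂, KU, KV, KL1, K31, K22, KL3, smul_mul_assoc, mul_smul_comm, smul_smul] <;> module

/-- **Weight separation**: the scaling endomorphism `σ_c` multiplies the defect functional of a
homogeneous pattern of degree `d` by `c^d`. [folklore] -/
theorem scale_pentD {N : ℕ} {c : R} (σ : DrinfeldKohnoTrunc R (Fin 4) N →ₐ[R] DrinfeldKohnoTrunc R (Fin 4) N)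
    (hσ : ∀ i j, σ (t R N i j) = c • t R N i j)
    (K : DrinfeldKohnoTrunc R (Fin 4) N → DrinfeldKohnoTrunc R (Fin 4) N → DrinfeldKohnoTrunc R (Fin 4) N)
    (e : R) (hmap : ∀ A B, σ (K A B) = K (σ A) (σ B)) (hsmul : ∀ A B, K (c • A) (c • B) = e • K A B) :
    σ (pentD R N K) = e • pentD R N K := by
  have hσ2 : ∀ i j k l, σ (t R N i j + t R N k l) = c • (t R N i j + t R N k l) := by
    intros; rw [map_add, hσ, hσ, smul_add]
  simp only [pentD, map_sub, map_add]
  simp only [hmap]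
  simp only [hσ2, hσ]
  simp only [hsmul]
  simp only [smul_sub, smul_add]

/-- The scaling endomorphism on the cross term: `σ_c X = c⁴ X`. [folklore] -/
theorem scale_pentX {N : ℕ} {c : R} (σ : DrinfeldKohnoTrunc R (Fin 4) N →ₐ[R] DrinfeldKohnoTrunc R (Fin 4) N)
    (hσ : ∀ i j, σ (t R N i j) = c • t R N i j) : σ (pentX R N) = (c * c * c * c) • pentX R N := by
  have hK2 : ∀ A B, σ (K₂ A B) = K₂ (σ A) (σ B) := fun A B => (map_KU' σ A B).2.2
  have hs : ∀ A B : DrinfeldKohnoTrunc R (Fin 4) N, K₂ (c • A) (c • B) = (c * c) • K₂ A B := fun A B =>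
    (smul_patterns c A B).1
  have hσ2 : ∀ i j k l, σ (t R N i j + t R N k l) = c • (t R N i j + t R N k l) := by
    intros; rw [map_add, hσ, hσ, smul_add]
  simp only [pentX, map_sub, map_mul]
  simp only [hK2]
  simp only [hσ2, hσ]
  simp only [hs]
  simp only [smul_mul_assoc, mul_smul_comm, smul_smul, smul_sub, mul_assoc]

end Level4


end Pending18d_WeightFourLinear

section Pending18efg_WeightFourTightness

open Summit.KontsevichZagierPeriods.KontsevichZagierPeriods.Theses.FurushoPentagon (PentagonInKZ)

/-! ## §18e (continued) The identities `D[U] = D[V]` and `10X = 4D[L₁] - D[W₃₁] - 3D[K₂²] + 4D[L₃]` -/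

section Universal

open DrinfeldKohnoTrunc

/-- **The level-4 identities over `ℝ`**, read off Drinfeld's theorem for `Φ_KZ` after separating
the weight-3 and weight-4 parts with the scaling `σ₂` (`8·T₃ + 16·T₄ = 0 = T₃ + T₄`): `D[U] = D[V]`
at level 4 (from `ζ(3)·(D[V] - D[U]) = 0`) and `10·X = 4D[L₁] - D[W₃₁] - 3D[K₂²] + 4D[L₃]` (from
the four weight-4 MZV relations and `ζ(2)² ≠ 0`). [cite: Drinfeld1991, (2.13); BarNatan1998, §3] -/
theorem level4_identities_real :
    pentD ℝ 4 KU = pentD ℝ 4 KV ∧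
      (10 : ℝ) • pentX ℝ 4 = (4 : ℝ) • pentD ℝ 4 KL1 - pentD ℝ 4 K31 - (3 : ℝ) • pentD ℝ 4 K22 +
        (4 : ℝ) • pentD ℝ 4 KL3 := by
  set φ := cruxSeries ℝ KZ.eval simplexZ with hφdef
  have hpent : NCSeries.DrinfeldPentagon φ := by
    rw [hφdef, cruxSeries_eval_eq_drinfeldAssociator simplexZ_agrees]
    exact drinfeldAssociator_pentagon_holds
  have h0 : φ [] = 1 := cruxSeries_nil_eq_one KZ.eval simplexZ isRealisation_eval simplexZ_agrees
  have hx : φ [false] = 0 := cruxSeries_x _ _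
  have hy : φ [true] = 0 := cruxSeries_y _ _
  have hxx : φ [false, false] = 0 := cruxSeries_xx _ _
  have hyy : φ [true, true] = 0 := cruxSeries_yy _ _
  have hyx : φ [true, false] = -φ [false, true] := by rw [hφdef, cruxSeries_yx, cruxSeries_xy, neg_neg]
  have h3 := NCSeries.DrinfeldPentagon.apply_weight_three hpent h0 hx hy
  obtain ⟨h4a, h4b, h4c, h4d⟩ := NCSeries.DrinfeldPentagon.apply_weight_four hpent h0 hx hy hxx hyy hyx
  have hlin := (pentAt_four_iff_of_shape h0 hx hy hxx hyy hyx (cruxSeries_xxx _ _) (cruxSeries_yyy _ _)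
    (by rw [hφdef, cruxSeries_xyx, cruxSeries_xxy]; ring) (by rw [hφdef, cruxSeries_yxx, cruxSeries_xxy])
    (by rw [hφdef, cruxSeries_yxy, cruxSeries_xyy]) (by rw [hφdef, cruxSeries_yyx, cruxSeries_xyy])
    (cruxSeries_xxxx _ _) (cruxSeries_yyyy _ _) (cruxSeries_xxyx _ _) (cruxSeries_xyxx _ _)
    (cruxSeries_yxxx _ _) (cruxSeries_xyyx _ _) (cruxSeries_yxxy _ _) (cruxSeries_yxyx _ _)
    (cruxSeries_yyxx _ _) (cruxSeries_yxyy _ _) (cruxSeries_yyxy _ _) (cruxSeries_yyyx _ _)).mp (hpent 4)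
  rw [pentD_K₂_eq_zero, smul_zero, zero_add] at hlin
  -- scalars
  set c := φ [false, true] with hc
  set p := φ [false, false, true] with hp
  set q := φ [false, true, true] with hq
  set a1 := φ [false, false, false, true] with ha1
  set a31 := φ [false, false, true, true] with ha31
  set a22 := φ [false, true, false, true] with ha22
  set a211 := φ [false, true, true, true] with ha211
  -- the two homogeneous parts
  obtain ⟨T3, hT3⟩ : ∃ T3 : DrinfeldKohnoTrunc ℝ (Fin 4) 4, T3 = p • pentD ℝ 4 KU + q • pentD ℝ 4 KV :=
    ⟨_, rfl⟩
  obtain ⟨T4, hT4⟩ : ∃ T4 : DrinfeldKohnoTrunc ℝ (Fin 4) 4, T4 = a1 • pentD ℝ 4 KL1 + a31 • pentD ℝ 4 K31 +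
      a22 • pentD ℝ 4 K22 + a211 • pentD ℝ 4 KL3 + (c * c) • pentX ℝ 4 := ⟨_, rfl⟩
  have hsum : T3 + T4 = 0 := by
    rw [hT3, hT4]
    refine Eq.trans ?_ hlin
    abel
  -- weight separation by the scaling σ₂
  obtain ⟨σ, hσ⟩ := exists_scaleHom ℝ (Fin 4) 4 (2 : ℝ)
  have hσ3 : σ T3 = (2 * 2 * 2 : ℝ) • T3 := by
    rw [hT3, map_add, _root_.map_smul, _root_.map_smul,
      scale_pentD σ hσ KU (2 * 2 * 2) (fun A B => (map_KU' σ A B).1) (fun A B => (smul_patterns 2 A B).2.1),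
      scale_pentD σ hσ KV (2 * 2 * 2) (fun A B => (map_KU' σ A B).2.1)
        (fun A B => (smul_patterns 2 A B).2.2.1)]
    module
  have hσ4 : σ T4 = (2 * 2 * 2 * 2 : ℝ) • T4 := by
    rw [hT4, map_add, map_add, map_add, map_add, _root_.map_smul, _root_.map_smul, _root_.map_smul, _root_.map_smul,
      _root_.map_smul,
      scale_pentD σ hσ KL1 (2 * 2 * 2 * 2) (map_KL1 σ) (fun A B => (smul_patterns 2 A B).2.2.2.1),
      scale_pentD σ hσ K31 (2 * 2 * 2 * 2) (map_K31 σ) (fun A B => (smul_patterns 2 A B).2.2.2.2.1),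
      scale_pentD σ hσ K22 (2 * 2 * 2 * 2) (map_K22 σ) (fun A B => (smul_patterns 2 A B).2.2.2.2.2.1),
      scale_pentD σ hσ KL3 (2 * 2 * 2 * 2) (map_KL3 σ) (fun A B => (smul_patterns 2 A B).2.2.2.2.2.2),
      scale_pentX σ hσ]
    module
  have hsep : (2 * 2 * 2 : ℝ) • T3 + (2 * 2 * 2 * 2 : ℝ) • T4 = 0 := by
    rw [← hσ3, ← hσ4, ← map_add, hsum, map_zero]
  have hT4zero : T4 = 0 := by
    have hT3' : T3 = -T4 := eq_neg_of_add_eq_zero_left hsum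
    rw [hT3', smul_neg] at hsep
    have h8 : (8 : ℝ) • T4 = 0 := by
      have e : (8 : ℝ) • T4 = -((2 * 2 * 2 : ℝ) • T4) + (2 * 2 * 2 * 2 : ℝ) • T4 := by module
      rw [e, hsep]
    have := congrArg (fun x => (8 : ℝ)⁻¹ • x) h8
    simpa only [inv_smul_smul₀ (show (8 : ℝ) ≠ 0 by norm_num), smul_zero] using this
  have hT3zero : T3 = 0 := by rwa [hT4zero, add_zero] at hsum
  constructor
  · -- weight 3: `p (D[U] - D[V]) = 0`, `p = -ζ(3) ≠ 0`
    have hq' : q = -p := by linear_combination h3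
    rw [hT3, hq', neg_smul, ← sub_eq_add_neg, ← smul_sub] at hT3zero
    have hpne : p ≠ 0 := by
      rw [hp, hφdef, cruxSeries_xxy, neg_ne_zero, simplexZ_agrees [3] (by decide), KZ.eval_of,
        KZ.mzvRep_value_holds]
      exact (multipleZeta_pos_of_isAdmissible_holds (by decide)).ne'
    have := congrArg (fun x => p⁻¹ • x) hT3zero
    simp only [inv_smul_smul₀ hpne, smul_zero] at this
    exact sub_eq_zero.mp this
  · -- weight 4: `c² (10X - 4D₁ + D₃₁ + 3D₂₂ - 4D₃) = 0`, `c = -ζ(2) ≠ 0`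
    have ea1 : 10 * a1 = -4 * (c * c) := by linear_combination 2 * h4a
    have ea31 : 10 * a31 = c * c := by linear_combination h4b
    have ea22 : 10 * a22 = 3 * (c * c) := by linear_combination h4c
    have ea211 : 10 * a211 = -4 * (c * c) := by linear_combination 2 * h4d
    have h10 : (10 : ℝ) • T4 = (c * c) • ((10 : ℝ) • pentX ℝ 4 -
        ((4 : ℝ) • pentD ℝ 4 KL1 - pentD ℝ 4 K31 - (3 : ℝ) • pentD ℝ 4 K22 + (4 : ℝ) • pentD ℝ 4 KL3)) := by
      rw [hT4]
      simp only [smul_add, smul_smul]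
      rw [ea1, ea31, ea22, ea211]
      module
    rw [hT4zero, smul_zero] at h10
    have hcne : c * c ≠ 0 := by
      have hc0 : c ≠ 0 := by
        rw [hc, hφdef, cruxSeries_xy, neg_ne_zero, simplexZ_agrees [2] (by decide), KZ.eval_of,
          KZ.mzvRep_value_holds]
        exact (multipleZeta_pos_of_isAdmissible_holds (by decide)).ne'
      exact mul_ne_zero hc0 hc0
    have := congrArg (fun x => (c * c)⁻¹ • x) h10.symm
    simp only [inv_smul_smul₀ hcne, smul_zero] at this
    exact (sub_eq_zero.mp this)

variable {R : Type} [CommRing R]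

/-- Base change of the weight-4 defect functionals and of the cross term. [folklore] -/
theorem map_level4 {S : Type} [CommRing S] (f : R →+* S) :
    DrinfeldKohnoTrunc.map f (pentD R 4 KL1) = pentD S 4 KL1 ∧
      DrinfeldKohnoTrunc.map f (pentD R 4 K31) = pentD S 4 K31 ∧
      DrinfeldKohnoTrunc.map f (pentD R 4 K22) = pentD S 4 K22 ∧
      DrinfeldKohnoTrunc.map f (pentD R 4 KL3) = pentD S 4 KL3 ∧
      DrinfeldKohnoTrunc.map f (pentX R 4) = pentX S 4 := by
  refine ⟨?_, ?_, ?_, ?_, ?_⟩ <;>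
    simp only [pentD, pentX, KL1, K31, K22, KL3, K₂, map_sub, map_add, map_mul,
      DrinfeldKohnoTrunc.map_smul, DrinfeldKohnoTrunc.map_t, map_ofNat]

/-- **The level-4 identities over every commutative `ℚ`-algebra** (from `ℝ` by injectivity of base
change from `ℚ`, then functoriality). [folklore] -/
theorem level4_identities (R : Type) [CommRing R] [Algebra ℚ R] :
    pentD R 4 KU = pentD R 4 KV ∧
      (10 : R) • pentX R 4 = (4 : R) • pentD R 4 KL1 - pentD R 4 K31 - (3 : R) • pentD R 4 K22 +
        (4 : R) • pentD R 4 KL3 := by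
  obtain ⟨hUV, hX⟩ := level4_identities_real
  have hqUV : pentD ℚ 4 KU = pentD ℚ 4 KV := by
    apply DrinfeldKohnoTrunc.map_injective (Fin 4) 4 (algebraMap ℚ ℝ).injective
    rw [map_pentD_KU, map_pentD_KV]; exact hUV
  obtain ⟨m1, m31, m22, m3, mX⟩ := map_level4 (algebraMap ℚ ℝ)
  have hqX : (10 : ℚ) • pentX ℚ 4 = (4 : ℚ) • pentD ℚ 4 KL1 - pentD ℚ 4 K31 - (3 : ℚ) • pentD ℚ 4 K22 +
      (4 : ℚ) • pentD ℚ 4 KL3 := by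
    apply DrinfeldKohnoTrunc.map_injective (Fin 4) 4 (algebraMap ℚ ℝ).injective
    simp only [map_sub, map_add, DrinfeldKohnoTrunc.map_smul, m1, m31, m22, m3, mX, map_ofNat]
    exact hX
  obtain ⟨n1, n31, n22, n3, nX⟩ := map_level4 (algebraMap ℚ R)
  constructor
  · have h := congrArg (DrinfeldKohnoTrunc.map (ι := Fin 4) (N := 4) (algebraMap ℚ R)) hqUV
    rwa [map_pentD_KU, map_pentD_KV] at h
  · have h := congrArg (DrinfeldKohnoTrunc.map (ι := Fin 4) (N := 4) (algebraMap ℚ R)) hqX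
    simp only [map_sub, map_add, DrinfeldKohnoTrunc.map_smul, n1, n31, n22, n3, nX, map_ofNat] at h
    exact h

/-! ## §18f The level-4 pentagon FROM the four weight-4 relations -/

/-- **The level-4 pentagon holds for every series of regularised shape with `c_{xxy} + c_{xyy} = 0`
and the four weight-4 relations `5α₁ = -2c²`, `10α₃₁ = c²`, `10α₂₂ = 3c²`, `5α₂₁₁ = -2c²`** —
converse of `DrinfeldPentagon.apply_weight_four` at level 4. [cite: BarNatan1998, §3] -/
theorem pentAt_four_of_shape [Algebra ℚ R] {φ : NCSeries Bool R} (hφ : φ [] = 1) (h0 : φ [false] = 0)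
    (h1 : φ [true] = 0) (hff : φ [false, false] = 0) (htt : φ [true, true] = 0)
    (htf : φ [true, false] = -φ [false, true]) (hfff : φ [false, false, false] = 0)
    (httt : φ [true, true, true] = 0) (hftf : φ [false, true, false] = -2 * φ [false, false, true])
    (htff : φ [true, false, false] = φ [false, false, true])
    (htft : φ [true, false, true] = -2 * φ [false, true, true])
    (httf : φ [true, true, false] = φ [false, true, true])
    (hffff : φ [false, false, false, false] = 0) (htttt : φ [true, true, true, true] = 0)
    (hfftf : φ [false, false, true, false] = -3 * φ [false, false, false, true])
    (hftff : φ [false, true, false, false] = 3 * φ [false, false, false, true])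
    (htfff : φ [true, false, false, false] = -φ [false, false, false, true])
    (hfttf : φ [false, true, true, false] =
      -2 * φ [false, false, true, true] - φ [false, true, false, true])
    (htfft : φ [true, false, false, true] =
      -φ [false, true, false, true] - 2 * φ [false, false, true, true])
    (htftf : φ [true, false, true, false] =
      φ [false, true, false, true] + 4 * φ [false, false, true, true])
    (httff : φ [true, true, false, false] = -φ [false, false, true, true])
    (htftt : φ [true, false, true, true] = -3 * φ [false, true, true, true])
    (httft : φ [true, true, false, true] = 3 * φ [false, true, true, true])
    (htttf : φ [true, true, true, false] = -φ [false, true, true, true])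
    (hpq : φ [false, false, true] + φ [false, true, true] = 0)
    (h4a : 5 * φ [false, false, false, true] + 2 * (φ [false, true] * φ [false, true]) = 0)
    (h4b : 10 * φ [false, false, true, true] - φ [false, true] * φ [false, true] = 0)
    (h4c : 10 * φ [false, true, false, true] - 3 * (φ [false, true] * φ [false, true]) = 0)
    (h4d : 5 * φ [false, true, true, true] + 2 * (φ [false, true] * φ [false, true]) = 0) :
    NCSeries.PentAt φ 4 := by
  rw [pentAt_four_iff_of_shape hφ h0 h1 hff htt htf hfff httt hftf htff htft httf hffff htttt hfftf hftff
    htfff hfttf htfft htftf httff htftt httft htttf, pentD_K₂_eq_zero, smul_zero, zero_add]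
  obtain ⟨hUV, hX⟩ := level4_identities R
  rw [hUV, ← add_smul, hpq, zero_smul, zero_add]
  set c := φ [false, true]
  have ea1 : 10 * φ [false, false, false, true] = -4 * (c * c) := by linear_combination 2 * h4a
  have ea31 : 10 * φ [false, false, true, true] = c * c := by linear_combination h4b
  have ea22 : 10 * φ [false, true, false, true] = 3 * (c * c) := by linear_combination h4c
  have ea211 : 10 * φ [false, true, true, true] = -4 * (c * c) := by linear_combination 2 * h4d
  have hu := NCSeries.isUnit_natCast_of_ne_zero (S := R) (n := 10) (by norm_num)
  rw [Nat.cast_ofNat] at hu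
  rw [← hu.smul_left_cancel (y := (0 : DrinfeldKohnoTrunc R (Fin 4) 4)), smul_zero]
  have e : (10 : R) • (φ [false, false, false, true] • pentD R 4 KL1 +
      φ [false, false, true, true] • pentD R 4 K31 + φ [false, true, false, true] • pentD R 4 K22 +
      φ [false, true, true, true] • pentD R 4 KL3 + (c * c) • pentX R 4) =
      (10 * φ [false, false, false, true]) • pentD R 4 KL1 + (10 * φ [false, false, true, true]) • pentD R 4 K31 +
      (10 * φ [false, true, false, true]) • pentD R 4 K22 + (10 * φ [false, true, true, true]) • pentD R 4 KL3 +
      (c * c) • ((10 : R) • pentX R 4) := by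
    simp only [smul_add, smul_smul]
    congr 1
    rw [mul_comm]
  rw [e, ea1, ea31, ea22, ea211, hX]
  module

end Universal

/-! ## §18g The crux modulo weight 5 -/

section Crux4

variable {R : Type} [CommRing R] [Algebra ℚ R] {χ : KZ.FormalRep →+ R} {Z : List ℕ → KZ.FormalRep}

/-- **The four weight-4 class relations give the level-4 pentagon of `Φ_χ`** (in every realisation;
duality at weight 3 is automatic, `chi_Z3_eq_Z21`). [cite: Furusho2011, §2] -/
theorem cruxSeries_pentAt_four_of_weightFour (hχ : IsRealisation R χ) (hZ : AgreesWithSimplex Z)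
    (h4 : 5 * χ (Z [4]) = 2 * χ (Z [2]) ^ 2) (h31 : 10 * χ (Z [3, 1]) = χ (Z [2]) ^ 2)
    (h22 : 10 * χ (Z [2, 2]) = 3 * χ (Z [2]) ^ 2) (h211 : 5 * χ (Z [2, 1, 1]) = 2 * χ (Z [2]) ^ 2) :
    NCSeries.PentAt (cruxSeries R χ Z) 4 :=
  pentAt_four_of_shape (cruxSeries_nil_eq_one χ Z hχ hZ) (cruxSeries_x χ Z) (cruxSeries_y χ Z)
    (cruxSeries_xx χ Z) (cruxSeries_yy χ Z) (by rw [cruxSeries_yx, cruxSeries_xy, neg_neg])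
    (cruxSeries_xxx χ Z) (cruxSeries_yyy χ Z) (by rw [cruxSeries_xyx, cruxSeries_xxy]; ring)
    (by rw [cruxSeries_yxx, cruxSeries_xxy]) (by rw [cruxSeries_yxy, cruxSeries_xyy])
    (by rw [cruxSeries_yyx, cruxSeries_xyy]) (cruxSeries_xxxx χ Z) (cruxSeries_yyyy χ Z)
    (cruxSeries_xxyx χ Z) (cruxSeries_xyxx χ Z) (cruxSeries_yxxx χ Z) (cruxSeries_xyyx χ Z)
    (cruxSeries_yxxy χ Z) (cruxSeries_yxyx χ Z) (cruxSeries_yyxx χ Z) (cruxSeries_yxyy χ Z)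
    (cruxSeries_yyxy χ Z) (cruxSeries_yyyx χ Z)
    (by rw [cruxSeries_xxy, cruxSeries_xyy, chi_Z3_eq_Z21 hχ hZ]; ring)
    (by rw [cruxSeries_xxxy, cruxSeries_xy]; linear_combination -h4)
    (by rw [cruxSeries_xxyy, cruxSeries_xy]; linear_combination h31)
    (by rw [cruxSeries_xyxy, cruxSeries_xy]; linear_combination h22)
    (by rw [cruxSeries_xyyy, cruxSeries_xy]; linear_combination -h211)

/-- **THIRD RUNG: the crux holds modulo weight 5 in every realisation satisfying the four weight-4
class relations** (`5z₄ = 2z₂²`, `10z₃₁ = z₂²`, `10z₂₂ = 3z₂²`, `5z₂₁₁ = 2z₂²`; levels `≤ 3` are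
unconditional).  With `weight_four_content` (the crux forces them) this pins the third rung of
`PentagonInKZ` exactly. [cite: Furusho2011, §2] -/
theorem pentAt_le_four_of_weightFour (hχ : IsRealisation R χ) (hZ : AgreesWithSimplex Z)
    (h4 : 5 * χ (Z [4]) = 2 * χ (Z [2]) ^ 2) (h31 : 10 * χ (Z [3, 1]) = χ (Z [2]) ^ 2)
    (h22 : 10 * χ (Z [2, 2]) = 3 * χ (Z [2]) ^ 2) (h211 : 5 * χ (Z [2, 1, 1]) = 2 * χ (Z [2]) ^ 2) :
    ∀ N ≤ 4, NCSeries.PentAt (cruxSeries R χ Z) N := by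
  intro N hN
  rcases Nat.lt_or_ge N 4 with hlt | hge
  · exact pentAt_le_three hχ hZ N (by omega)
  · obtain rfl : N = 4 := le_antisymm hN hge
    exact cruxSeries_pentAt_four_of_weightFour hχ hZ h4 h31 h22 h211

end Crux4

end Pending18efg_WeightFourTightness

/-! ## §17 (generation 3) TARGETS — the lead's reshaped skeleton `logfree-gauge-corner-flatness`

Registered skeleton sha `5b456436…` (2026-08-16T01:16Z), file
`Cruxes/PentagonInKZ/Lines/logfree-gauge-corner-flatness.lean`.  Cheap-attack verdicts of the
standing adversary (signature level + truth at `χ = eval`; a `∀ χ`-stub that is TRUE at `eval` can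
only fail through an exotic realisation, i.e. through a disproof of the summit — §7):

* `stub_pathFamilies` [M] — TRUE.  Words not ending in the letter `0` give absolutely convergent
  integrands (`≤ C ∏_{i<n-1} 1/tᵢ`, integral `∫₀^z log^{n-1}(z/t)/(n-1)! dt < ∞`); no pole of
  `s_p` lies in `(0, bound p]` for any of the three charts; `w = []` gives the unit `[pt, 1]`.
* `stub_shuffleProduct` [M] — TRUE at eval (shuffle product of iterated integrals) and a genuine
  dissection: `Δ_u × Δ_v` minus null tie-walls is the disjoint union over the interleavings
  (list `MZV.shuffleWord u v`, multiplicities = distinct position sets) of coordinate permutations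
  of `Δ_w`; every shuffle of two words not ending in `0` does not end in `0`, so all terms are
  pinned by the `I`-hypothesis.  Moves (1a) + (2) only.
* `stub_groupLike` [M] — TRUE: `regEnd₀` is a `ш`-homomorphism onto the words not ending in `0`
  (constant term of `ℚ⟨A⟩ = 𝔥_end⁰[0]`), and `χ ∘ [I p ·]` is a `ш`-character on those words by
  `stub_shuffleProduct` + multiplicativity of `χ`; `P p [] = 1` by the `if`.  Pure algebra
  (`ShuffleAlgebra.endSystem`, `TaylorSystem.taylor_mul`).  NB the identity needed is for ALL
  pairs of words over `Fin 3` including those with the letter `2` and those ending in `0`.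
* `stub_halfEdgeUniversal` [L] — TRUE at eval, and an identity in the FREE algebra on `x, y`:
  with `H(A,B) = G₀(z) z^{-A}` the log-free tangential transport (`H' = [A,H]/z + B H/(z-1)`,
  `H(0) = 1`, group-like, `H(A-word) = 0`, equal to the convergent iterated integrals on words
  not ending in `A`, hence `= ⟨eval∘I₅, regEnd₀ ·⟩` by `Shuffle.pair_regEnd`) and
  `G₁(t) = H^{sw}(1-t)(1-t)^{B}`, Drinfeld's `Φ = G₁(½)⁻¹G₀(½)` reads
  `H(y,x) e^{λy} Φ(x,y) = H(x,y) e^{λx}`, `λ = log ½ = [∫₀^{1/2} dt/(t-1)]` — checked by hand in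
  weight `≤ 2` (`c_{xy} = -ζ(2)` needs Euler's `Li₂(½)` identity `ζ(2) = 2Li₂(½) + log²2`, i.e.
  in classes `2[I₅(0,1)] + ⟦ζ(2)⟧ = [I₅(1)]²`: the dissection of `Δ₂` by the hyperplanes
  `tᵢ = ½` + the reflection `t ↦ 1-t` + one Fubini product — an honest move chain) and
  numerically to weight 6 (job recorded below).  Degenerate instances `N = 0`, `x = y`, `x = 0`
  are harmless (free-algebra identity specialises).  As a `∀χ` statement its weight-`n` content is
  the path-composition-at-`½` family of relations among simplex classes over `(0,½)` and MZV
  classes — dissections, affine changes of variables and Fubini products throughout.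
* `stub_chartB` [M] — TRUE at eval: the Möbius chart `t = s/(1-s)` maps `(0,½) → (0,1)`, the
  poles `0, -1, ∞ ↦ 0, ∞, 1`, `dt/t = ds/s - ds/(s-1)`, `dt/(t+1) = -ds/(s-1)` (hence the
  argument `![x, -x-w, 0]`), has unit speed at the base point (so the `log ↦ 0` regularisations
  agree) and the endpoint normalisations differ by `(½)^{x} = e^{λx}`; Jacobian
  `∏ 1/(1-sᵢ)²`, so coefficientwise `[I₁₀ w] = Σ ± [I₅ w']` by ONE change of variables plus
  integrand additivity (all words produced end in the letter `1`, convergent).  Numerically to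
  weight 6 (job below).
* `stub_logfreeCorners` [XL, held by the lead] — weight-1 check of all five corners by hand PASSES
  (including the entry `a+a+b+c = 2t₀₁+t₀₂+t₁₂` of leg 2, which is forced:
  `-2La - Lb - Lc + log(3/2)d` on both sides of corner 3); full check to weight 4 modulo the
  `U𝔱₄` ideal by the numerics job.  As a `∀χ` statement it asserts, weight by weight, relations
  among classes of Li-values at `½, ¼, ¾, -½, 3/2`-type arguments (three-pole transports on the
  legs) — the two-dimensional content of the crux is concentrated here; nothing refutes it short
  of an exotic realisation.

No `stub_false` or `stub-misstated` finding this cycle.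

INDEPENDENT CONFIRMATION (drefute seat, `Cruxes/PentagonInKZ/StubsSurvived-logfree-gauge-corner-flatness.md`):
all ten atlas identities verified at `χ = eval` to `N = 5` in an exact `U𝔱₄` normal form, controls failing
`O(1)`; my job j009332 re-verifies to `N = 4` (ideal reduction) / `N = 6` (free-algebra identities).

§17b SECOND LEAD (unit `…-11348-b`, line `edge-normal-newton-leibniz`, skeleton
`Lines/edge-normal-newton-leibniz.lean`, 2026-08-16T03:40Z): shared stubs as above plus
`stub_cornerPrinciple` [XL], `stub_cornersCubical` [L], `stub_cornersBlowup` [L].  Verdict on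
`stub_cornerPrinciple` (general LOG-FREE CORNER PRINCIPLE: flat `Ω = Σ Z_k dlog φ_k`, bilinear `φ_k`,
`φ₀ = ξ`, `φ₁ = η`, other `φ_k ≠ 0` on the CLOSED rectangle, `[Z₀,Z₁] = 0`, edge centralities
`[Z₀, g(0,η)] = 0`, `[Z₁, f(ξ,0)] = 0` ⟹ `V_α(β)H_0(α) = H_β(α)V_0(β)` for the log-free side transports,
in every realisation): TRUE at `eval`, by an exact argument that consumes every hypothesis exactly once —
(1) gauged ODEs `∂_η P^v_x = g(x,η)P^v_x - P^v_x Z₁/η` (regular at `η = 0` by closed-rectangle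
non-vanishing) and the variation formula `∂_η P^h_η(α) = g(α,η)P^h_η(α) - P^h_η(α)g(0,η)` (exact for
`η > 0`; uses flatness and the LEFT-edge centrality); (2) for `G(η) := P^v_α(η)⁻¹ P^h_η(α) P^v_0(η)`
(log-free, `G(0) = H_0(α)`, `G(β) = V_α(β)⁻¹H_β(α)V_0(β)`) the exact identity **`η ∂_η G = [Z₁, G]`**;
(3) induction on the degree: `η∂_ηG_n = [Z₁,G_{n-1}] = 0` because `G_{n-1}` is already constant
`= (H_0(α))_{n-1}` and `Z₁` commutes with `H_0(α)` (BOTTOM-edge centrality + `[Z₀,Z₁] = 0`), so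
`G_n(β) = G_n(0)` by ONE Newton–Leibniz in `η` on the closed band with a log-free primitive.  Read-back
of the signature (product order = later path on the left, `regEnd 0`/`regEnd 1` on the right letters,
`Z` over `R` vs `Zr` over `ℝ` with the same integer matrix `nZ`): correct; degenerate instances
(`m = 0`; `N ≤ 1` where flatness is vacuous but the level-1 identity is `∮ dlog φ_k = 0`; the pull-back
family `c·dlog(ξη) + a·dlog(1-ξη)`, true by scale invariance of the log-free normalisation) pass.  No
stub-false / stub-misstated; evidence file `targets-cornerPrinciple.md` (also a free consult for the
lead: where each hypothesis is consumed, and the one place to probe — the `∂_ξ g_k ↔ ∂_η f_k` swap must be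
done on the `regEnd₀`-combination so that no `(1/ξ)·(…)` is ever evaluated at `ξ = 0`). -/


end Summit.KontsevichZagierPeriods.FurushoPentagon.PentagonInKZNegative
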